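import Literature.MathematicalPhysics.QuantumFieldTheory.ContinuumLimitsPhi4GaussianDomination
import Literature.MathematicalPhysics.QuantumLattice.Phi4WickDeviation
import Literature.MathematicalPhysics.QuantumLattice.Phi4TwoPointDoubling
import Literature.Probability.LatticeModels.AizenmanWickBound
import HarnessLib

/-!
# constructive-qft.S24: `phi44_triviality` (and `phi4_highDim_triviality`) from the `U₄` smallness — the summation layer, proved

Proofs-only companion of `ContinuumLimits.lean` (the named fact
`Literature.MathematicalPhysics.QuantumFieldTheory.phi44_triviality`, Aizenman–Duminil-Copin 2021,
Thm 1.2 for the lattice `φ⁴₄` scaling limits, and its barrier alias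
`Literature.Barriers.QuantumFields.ScalarPhi4Triviality`). **Theorems only: no statement of the tree
is changed, no definition and no named fact is introduced** (D-0026).

It sits between the two existing ends of the `φ⁴` line:

* below: the finite-volume correlation inequalities for the free-boundary lattice `φ⁴` measures
  obtained through the Griffiths–Simon / block-Ising approximation (`GriffithsSimonApproximation`,
  `Phi4NewmanGaussianInequality`, `Phi4BoxGaussianBounds`: the lower half `S_{2n} ≤ 𝒢_n[S₂]` of
  ADC (6.3), Newman's Gaussian domination) and their law-level form
  (`ContinuumLimitsPhi4GaussianDomination`);
* above: the law-level assembly `phi44_triviality_of_mgfDeviation` /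
  `phi44_triviality_of_scaleBound` (the remark printed after ADC Prop. 1.4, p. 6: Gaussianity from
  the exponential-moment estimate).

What is proved here is the layer in between — Aizenman–Duminil-Copin's §6.3 ("Proof of
Proposition 1.4", p. 26, run for the `φ⁴` states as in §7, p. 28): smearing the Wick sandwich
against the test function, summing over `n`, passing to the thermodynamic limit `R → ∞` along the
convergence in law, and the bookkeeping of the scaling window — so that `phi44_triviality` is
reduced to three correlation-function statements about the free-boundary box states
(`phi44_triviality_of_wickDeviation`):

* `hW`: the upper half of the Wick sandwich in the form of Aizenman 1982, Prop. 12.1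
  (`|S_{2n} - 𝒢_n[S₂]| ≤ (3/2) R_{2n}`, `R_{2n} = ∑_{4-subsets} |U₄| 𝒢_{n-2}`; the tree's
  `wickRemainder`/`pairingSum`, cf. `AizenmanWickBound` where the Ising statement is vendored and —
  in `AizenmanWickBoundProofs` — proved), for every box — a THEOREM for the lattice `φ⁴` box states
  (`phi4Box_wickDeviation_le` of `QuantumLattice/Phi4WickDeviation.lean`, through the block Ising
  approximation), so that `phi44_triviality_of_doubling_of_ursellFourSum` only assumes `hD` and `hU`;
* `hD`: a doubling bound `∑_{Λ_{rL}²} S₂^R ≤ C(r) ∑_{Λ_L²} S₂^R` (the indicator case of the printed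
  upper variance bound `⟨T_{f,L}²⟩ ≤ C_f`, ADC p. 6) — a THEOREM as well (`phi4TwoPointBox_doubling` of
  `QuantumLattice/Phi4TwoPointDoubling.lean`, on the thermodynamic limit of
  `QuantumLattice/Phi4VolumeMonotonicity.lean`), so that the final statement
  **`phi44_triviality_of_ursellFourSum`** assumes `hU` alone;
* `hU`: the printed smallness of `∑_{Λ_{rL}⁴} |U₄|` relative to `Σ_L²` in the window `L ≤ ξ`
  (ADC Prop. 7.2 via Thm 7.1 and §5 — the `φ⁴₄` substance of the source, the `φ⁴` twin of
  `Literature.Probability.LatticeModels.aizenmanDuminilCopin_ursellFourSum_le`).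

## Contents (all proved)

* Part A (finite volume, any `d`). `integral_pow_eval_latticeFieldLaw_phi4FreeMeasure` (moments of
  the smeared field `ω(f) = ρδᵈ ∑ f(δx) φₓ` as smeared correlation functions `nPoint`),
  `integral_pow_sub_wick_eq_sum` (the deviation from Wick's law, smeared: `sum_prod_mul_pairingSum`),
  and **`abs_integral_pow_sub_wick_le`**:
  `|∫ ω(f)^{2n} - (2n-1)!! (∫ ω(f)²)ⁿ| ≤ (3/2)(2n)⁴ 𝔘_Λ(f) (2n-5)!! (∫ ω(h)²)^{n-2}` for `h ≥ |f|` at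
  the lattice points, granted `hW` in `Λ` (the lower half is the tree's
  `phi4Free_nPoint_le_pairingSum`), with `𝔘_Λ(f) = ∑_{u ∈ Λ⁴} (∏ⱼ |ρδᵈ f(δuⱼ)|) |U₄^Λ(u)|` — the
  `φ⁴` counterpart of `abs_integral_normalizedField_pow_sub_le_of_wickBounds` (`AizenmanWickBound`,
  Part 4), without the `Σ_L^{-1/2}` normalisation.
* Part B (pure probability). `hasSum_integral_pow_div_factorial_of_integrable_exp` and
  **`abs_mgf_sub_exp_le_of_wickMoment_bounds_of_integrable_exp`**: the summation over `n`
  (`|E e^{zX} - e^{z²EX²/2}| ≤ 16 E z⁴ e^{z²W/2}`) for UNBOUNDED `X` with `e^{±zX}` integrable (the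
  tree's `abs_mgf_sub_exp_le_of_wickMoment_bounds` assumes `|X| ≤ K`, true for spins only).
* Part C (finite volume). `nPoint_phi4FreeMeasure_nonneg` (GKS I for `∏ φ_{xᵢ}`),
  `integral_even_pow_eval_le_of_abs_le` (even moments monotone in `|f|`),
  `integral_odd_pow_eval_latticeFieldLaw_phi4FreeMeasure` (odd moments vanish: evenness),
  `phi4_thermodynamicLimit_even_moment_bounded` (uniform Gaussian bounds along `R → ∞`).
* Part D (one mesh, any `d`). **`abs_mgf_sub_exp_le_of_thermodynamicLimit`**: for a limit in law `ν`
  of the box laws, `hW` in every box, a compactly supported `f` with majorant `h` and a reference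
  `χ ≥ 0`, and eventual bounds `𝔘_R(f) ≤ E ⟨ω(χ)²⟩_R²`, `⟨ω(h)²⟩_R ≤ C ⟨ω(χ)²⟩_R`:
  `|∫ e^{wω(f)} dν - e^{w²∫ω(f)²dν/2}| ≤ 24 E s² w⁴ e^{Csw²/2}`, `s = ∫ ω(χ)² dν`.
* Part E (bookkeeping). Plateau test functions, support cubes and bounds of compactly supported test
  functions, `latticeBox` inclusions, truncation of smeared sums to the support, the plateau lower
  bound `(ρδᵈ)² ∑_{Λ_{1/δ}²} S₂ ≤ ∫ ω(χ)²`, `law(|ρ|) = law(ρ)`.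
* Part F (one mesh). `eventually_smearedUrsellSum_le`, `eventually_variance_le_plateau`: the two
  eventual inputs of Part D from `hU`-type and `hD`-type bounds at mesh `δ`.
* Part G (`d = 4`). **`phi44_triviality_of_wickDeviation`**; with `hW` discharged by
  `phi4Box_wickDeviation_le`, `phi44_triviality_of_doubling_of_ursellFourSum`; with `hD` discharged by
  `phi4TwoPointBox_doubling`, **`phi44_triviality_of_ursellFourSum`**.
* Part H (`d ≥ 5`). **`phi4_highDim_triviality_of_ursellFourSum`**: the same reduction of the tree's
  `phi4_highDim_triviality` (Aizenman 1982 / Fröhlich 1982) to the `φ⁴` twin of Panis 2023, Thm 5.5 /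
  `panis_ursellFourSum_le` (no scaling window; `J(δ) ≥ J₀ > 0`).

## What is NOT here

The remaining input `hU` — ADC Thm 7.1 / Prop. 7.2 with the regularity estimates of §5, the core of the
Annals paper (random currents for the Griffiths–Simon class, the multiscale improvement of the tree
diagram bound by the bubble diagram, the sliding-scale infrared bound and Messager–Miracle-Solé for
`φ⁴`); hence not `phi44_triviality_holds`.

## Sources

* M. Aizenman, H. Duminil-Copin, *Marginal triviality of the scaling limits of critical 4D Ising and
  `φ⁴₄` models*, Ann. Math. 194 (2021) 163–235 = arXiv:1912.07973: Thm 1.2 (p. 4), Prop. 1.4 and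
  the display after it (p. 6), §6.3 (p. 26), Thm 7.1 / Prop. 7.2 (p. 28).
  [AizenmanDuminilCopinAnnals2021]
* M. Aizenman, *Geometric analysis of `φ⁴` fields and Ising models I, II*, Comm. Math. Phys. 86
  (1982) 1–48, Prop. 12.1, eq. (12.3) (the Wick sandwich with `R_{2n}`; as vendored in
  `AizenmanWickBound`). [AizenmanCMP1982]
* M. Aizenman, CDM 2020 (arXiv:2112.04248), §7, (7.6)–(7.9) (the summation). [AizenmanCDM2020]

## Tree anchors

`pairingSum`, `restrictFour`, `removeFour`, `sum_prod_mul_pairingSum`,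
`sum_prod_mul_removeFour_mul_restrictFour`, `card_fourSubsets_le` (`HighDimTrivialityWick`);
`wickRemainder`, `removeFour₂`, `two_mul_sub_two`, `sum_piFinset_prod_mul_comp_cast`
(`AizenmanWickBound`); `two_mul_pow_four_div_factorial_le` (`HighDimTrivialityMoments`); `nPoint`,
`connectedFour` (`Correlations`); `latticeBox`, `mem_latticeBox` (`HighDimTriviality`);
`phi4FreeMeasure`, `phi4BoxMeasure`, `phi4TwoPointIn`, `phi4TwoPointBox`, `latticeFieldLaw`,
`finLatticeField_apply`, `siteToE` (`LatticeScalarField`); `phi4TwoPointIn_nonneg`,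
`integral_eval_phi4Measure_nonneg`, `IsFerromagnetic` (`LatticeScalarFieldGriffithsProofs`);
`isProbabilityMeasure_phi4Measure_holds` (`LatticeScalarFieldProofs`); `integral_phi4FreeMeasure`,
`integral_latticeFieldLaw`, `integrable_phi4Measure_of_abs_le`,
`integral_sq_eval_latticeFieldLaw_phi4FreeMeasure`, `integrable_pow_eval_latticeFieldLaw_phi4FreeMeasure`,
`latticeFieldLaw_phi4Box_integral_pow_le`, `phi4Free_nPoint_le_pairingSum` (`Phi4BoxGaussianBounds`);
`tendsto_integral_pow_eval_of_tendstoInLaw`, `latticeFieldLaw_phi4FreeMeasure_neg_rho`,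
`latticeFieldLaw_phi4BoxMeasure_neg_rho`, `phi4_thermodynamicLimit_variance_bounded`,
`phi4_thermodynamicLimit_gaussianDomination`, `phi4_thermodynamicLimit_integrable_exp`,
`exists_nonneg_sub_of_hasCompactSupport`, `phi44_triviality_of_mgfDeviation`
(`ContinuumLimitsPhi4GaussianDomination`); `isProbabilityMeasure_of_tendstoInLaw`,
`isProbabilityMeasure_phi4BoxMeasure` (`ContinuumLimitsTrivialityProofs`). Mathlib:
`hasSum_integral_of_summable_integral_norm`, `NormedSpace.expSeries_div_hasSum_exp`,
`Real.sum_le_exp_of_nonneg`, `Real.exp_abs_le`, `summable_of_sum_range_le`, `ContDiffBump`,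
`HasCompactSupport.toSchwartzMap`, `HasCompactSupport.exists_bound_of_continuous`,
`PiLp.norm_apply_le`, `tendsto_inv_nhdsGT_zero`, `Finset.prod_univ_sum`, `Finset.sum_filter_of_ne`.
-/

noncomputable section

open MeasureTheory Filter Topology Finset
open scoped SchwartzMap

namespace Literature.MathematicalPhysics.QuantumFieldTheory

open Literature.MathematicalPhysics.QuantumLattice
open Literature.Probability.LatticeModels (box nPoint connectedFour pairingSum wickRemainder
  restrictFour removeFour removeFour₂ sum_prod_mul_pairingSum sum_prod_mul_removeFour_mul_restrictFour
  card_fourSubsets_le two_mul_sub_two sum_piFinset_prod_mul_comp_cast glueWith_apply_mem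
  glueWith_apply_not_mem latticeBox mem_latticeBox mem_box box_mono invCorrLength)
open Literature.Probability.LatticeModels renaming Site → ZSite

/-! ### Part A. Finite volume: moments of the smeared free-boundary `φ⁴` field and the Wick sandwich -/

section FiniteVolume

variable (d : ℕ)

/-- Growth bound for field monomials: `|∏ᵢ φ(xᵢ)| ≤ exp(m ∑_y φ_y²)` (`|u| ≤ 1 + u² ≤ e^{u²}`).
[folklore] -/
theorem abs_prod_apply_le_exp_mul {V : Type*} [Fintype V] {m : ℕ} (x : Fin m → V) (φ : V → ℝ) :
    |∏ i, φ (x i)| ≤ 1 * Real.exp (m * ∑ y, φ y ^ 2) := by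
  rw [Finset.abs_prod, one_mul]
  have h1 : ∀ i, |φ (x i)| ≤ Real.exp (∑ y, φ y ^ 2) := fun i => by
    have hsq : φ (x i) ^ 2 ≤ ∑ y, φ y ^ 2 :=
      Finset.single_le_sum (fun y _ => sq_nonneg (φ y)) (Finset.mem_univ (x i))
    have habs : |φ (x i)| ≤ φ (x i) ^ 2 + 1 := by
      nlinarith [sq_nonneg (|φ (x i)| - 1), sq_abs (φ (x i)), abs_nonneg (φ (x i))]
    exact habs.trans ((Real.add_one_le_exp _).trans (Real.exp_le_exp.2 hsq))
  calc ∏ i, |φ (x i)| ≤ ∏ _i : Fin m, Real.exp (∑ y, φ y ^ 2) :=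
        Finset.prod_le_prod (fun i _ => abs_nonneg _) fun i _ => h1 i
    _ = Real.exp (m * ∑ y, φ y ^ 2) := by
        rw [Finset.prod_const, Finset.card_univ, Fintype.card_fin, ← Real.exp_nat_mul]

/-- Field monomials are integrable under the free-boundary `φ⁴` measure in a finite volume
(`g > 0`): inside `Λ` by the Gaussian-exponential growth bound, and trivially (the monomial
vanishes identically) when one of the points lies outside `Λ`. [folklore] -/
theorem integrable_prod_apply_phi4FreeMeasure (Λ : Finset (ZSite d)) {g : ℝ} (hg : 0 < g)
    (κ J : ℝ) {m : ℕ} (p : Fin m → ZSite d) :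
    Integrable (fun φ : ZSite d → ℝ => ∏ i, φ (p i)) (phi4FreeMeasure d Λ g κ J) := by
  classical
  have hmeas : Measurable fun φ : ZSite d → ℝ => ∏ i, φ (p i) :=
    Finset.measurable_prod _ fun i _ => measurable_pi_apply (p i)
  unfold phi4FreeMeasure
  rw [integrable_map_measure hmeas.aestronglyMeasurable (measurable_glueZero Λ).aemeasurable]
  by_cases hp : ∀ i, p i ∈ Λ
  · have heq : ((fun φ : ZSite d → ℝ => ∏ i, φ (p i)) ∘ glueZero Λ) =
        fun ψ : Λ → ℝ => ∏ i, ψ ⟨p i, hp i⟩ := by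
      funext ψ
      simp only [Function.comp_apply]
      exact Finset.prod_congr rfl fun i _ => glueWith_apply_mem _ _ _ (hp i)
    rw [heq]
    exact integrable_phi4Measure_of_abs_le (zdGraphIn d Λ) hg κ J (by fun_prop)
      (abs_prod_apply_le_exp_mul (fun i => (⟨p i, hp i⟩ : Λ)))
  · push Not at hp
    obtain ⟨i, hi⟩ := hp
    haveI : IsProbabilityMeasure (phi4Measure (zdGraphIn d Λ) g κ J) :=
      isProbabilityMeasure_phi4Measure_holds _ hg κ J
    have heq : ((fun φ : ZSite d → ℝ => ∏ i, φ (p i)) ∘ glueZero Λ) = fun _ => 0 := by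
      funext ψ
      simp only [Function.comp_apply]
      exact Finset.prod_eq_zero (Finset.mem_univ i) (glueWith_apply_not_mem _ _ _ hi)
    rw [heq]
    exact integrable_const _

/-- **Moments of the smeared free-boundary `φ⁴` field as smeared correlation functions**:
`∫ ω(f)^m d(latticeFieldLaw (phi4FreeMeasure d Λ g κ J) Λ δ ρ) = ∑_{x ∈ Λ^m} (∏ᵢ a_{xᵢ}) S_m^Λ(x)`
with `aₓ = ρ δᵈ f(δx)` and `S_m^Λ = nPoint (phi4FreeMeasure d Λ g κ J) (φ ↦ φ_·)` (expand the
power of the sum and integrate termwise; Aizenman–Duminil-Copin 2021, §6.3, the passage from the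
first to the second display, for the lattice `φ⁴` field). [cite: AizenmanDuminilCopinAnnals2021, arXiv:1912.07973 §6.3 (p. 26)] -/
theorem integral_pow_eval_latticeFieldLaw_phi4FreeMeasure (Λ : Finset (ZSite d)) {g : ℝ}
    (hg : 0 < g) (κ J δ ρ : ℝ) (f : 𝓢(EuclideanSpace ℝ (Fin d), ℝ)) (m : ℕ) :
    ∫ ω, (ω f) ^ m ∂(latticeFieldLaw (phi4FreeMeasure d Λ g κ J) Λ δ ρ) =
      ∑ p ∈ Fintype.piFinset (fun _ : Fin m => Λ),
        (∏ i, (ρ * δ ^ d * f (δ • siteToE (p i)))) *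
          nPoint (phi4FreeMeasure d Λ g κ J) (fun (z : ZSite d) (φ : ZSite d → ℝ) => φ z) p := by
  classical
  rw [integral_latticeFieldLaw d _ Λ δ ρ ((measurable_eval f).pow_const m)]
  have hexp : ∀ φ : ZSite d → ℝ, (finLatticeField Λ δ ρ φ f) ^ m =
      ∑ p ∈ Fintype.piFinset (fun _ : Fin m => Λ),
        (∏ i, (ρ * δ ^ d * f (δ • siteToE (p i)))) * ∏ i, φ (p i) := fun φ => by
    rw [finLatticeField_apply, ← Fin.prod_const m, Finset.prod_univ_sum]
    refine Finset.sum_congr rfl fun p _ => ?_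
    rw [← Finset.prod_mul_distrib]
    exact Finset.prod_congr rfl fun i _ => by ring
  simp_rw [hexp]
  rw [integral_finsetSum _ fun p _ =>
    (integrable_prod_apply_phi4FreeMeasure d Λ hg κ J p).const_mul _]
  refine Finset.sum_congr rfl fun p _ => ?_
  rw [integral_const_mul]
  rfl

/-- **The deviation from Wick's law, smeared**: for every `n`,
`∫ ω(f)^{2n} - (2n)!/(2ⁿn!) (∫ ω(f)²)ⁿ = ∑_{x ∈ Λ^{2n}} (∏ᵢ a_{xᵢ}) (S^Λ_{2n}(x) - 𝒢_n[S₂^Λ](x))`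
for the smeared free-boundary `φ⁴` field (`sum_prod_mul_pairingSum`: the smeared pairing functional
is the Gaussian moment of the smeared variance). [cite: AizenmanDuminilCopinAnnals2021, arXiv:1912.07973 §6.3 (p. 26)] -/
theorem integral_pow_sub_wick_eq_sum (Λ : Finset (ZSite d)) {g : ℝ} (hg : 0 < g) (κ J δ ρ : ℝ)
    (f : 𝓢(EuclideanSpace ℝ (Fin d), ℝ)) (n : ℕ) :
    (∫ ω, (ω f) ^ (2 * n) ∂(latticeFieldLaw (phi4FreeMeasure d Λ g κ J) Λ δ ρ)) -
        ((2 * n).factorial : ℝ) / (2 ^ n * n.factorial) *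
          (∫ ω, (ω f) ^ 2 ∂(latticeFieldLaw (phi4FreeMeasure d Λ g κ J) Λ δ ρ)) ^ n =
      ∑ p ∈ Fintype.piFinset (fun _ : Fin (2 * n) => Λ),
        (∏ i, (ρ * δ ^ d * f (δ • siteToE (p i)))) *
          (nPoint (phi4FreeMeasure d Λ g κ J) (fun (z : ZSite d) (φ : ZSite d → ℝ) => φ z) p -
            pairingSum (phi4TwoPointIn d Λ g κ J) n p) := by
  rw [integral_pow_eval_latticeFieldLaw_phi4FreeMeasure d Λ hg κ J δ ρ f (2 * n),
    integral_sq_eval_latticeFieldLaw_phi4FreeMeasure d Λ hg κ J δ ρ f,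
    ← sum_prod_mul_pairingSum Λ (fun x => ρ * δ ^ d * f (δ • siteToE x)) (phi4TwoPointIn d Λ g κ J) n,
    ← Finset.sum_sub_distrib]
  exact Finset.sum_congr rfl fun p _ => by ring

/-- **Smearing the Wick sandwich for the free-boundary lattice `φ⁴` field** (Aizenman–Duminil-Copin
2021, §6.3, first ⟹ second display, for the `φ⁴` states of §7; Aizenman 1982, Prop. 12.1 and CDM
2020, (7.6)/(7.9)–(7.10)). Fix a finite volume `Λ ⊂ ℤᵈ`, `g > 0`, `J ≥ 0`, and suppose the
free-boundary `φ⁴` correlation functions in `Λ` satisfy the upper half of the Wick sandwich in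
Aizenman's form, `|S_{2n}^Λ(x) - 𝒢_n[S₂^Λ](x)| ≤ (3/2) R_{2n}^Λ(x)` for `n ≥ 2` and `x ∈ Λ^{2n}`
(hypothesis `hW`; the lower half `S_{2n}^Λ ≤ 𝒢_n[S₂^Λ]` is the tree's
`phi4Free_nPoint_le_pairingSum`). Then for Schwartz `f`, `h` with `|f(δx)| ≤ h(δx)` on `Λ` and
`n ≥ 2`, the smeared field `ω(f) = ρ δᵈ ∑_{x ∈ Λ} f(δx) φₓ` obeys
`|∫ ω(f)^{2n} - (2n)!/(2ⁿn!) (∫ ω(f)²)ⁿ| ≤ (3/2)(2n)⁴ 𝔘_Λ(f) · (2n-4)!/(2^{n-2}(n-2)!) (∫ ω(h)²)^{n-2}`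
with `𝔘_Λ(f) = ∑_{u ∈ Λ⁴} (∏ⱼ |ρ δᵈ f(δuⱼ)|) |U₄^Λ(u)|` (absolute values inside using
`𝒢_n - S_{2n} ≥ 0`, factorisation along each `4`-subset of the indices, `C(2n,4) ≤ (2n)⁴`, and the
smeared pairing functional of the remaining points is the Gaussian moment of the smeared variance,
bounded by that of `h` since `S₂^Λ ≥ 0`). [cite: AizenmanDuminilCopinAnnals2021, arXiv:1912.07973 §6.3 (p. 26) with §7 (p. 28)] [cite: AizenmanCMP1982, Prop. 12.1, eq. (12.3)] -/
theorem abs_integral_pow_sub_wick_le (Λ : Finset (ZSite d)) {g : ℝ} (hg : 0 < g) (κ : ℝ) {J : ℝ}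
    (hJ : 0 ≤ J) (δ ρ : ℝ) {f h : 𝓢(EuclideanSpace ℝ (Fin d), ℝ)}
    (hfh : ∀ x ∈ Λ, |f (δ • siteToE x)| ≤ h (δ • siteToE x))
    (hW : ∀ n : ℕ, 2 ≤ n → ∀ p : Fin (2 * n) → ZSite d, (∀ i, p i ∈ Λ) →
      |nPoint (phi4FreeMeasure d Λ g κ J) (fun (z : ZSite d) (φ : ZSite d → ℝ) => φ z) p -
          pairingSum (phi4TwoPointIn d Λ g κ J) n p| ≤
        3 / 2 * wickRemainder (phi4TwoPointIn d Λ g κ J)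
          (connectedFour (phi4FreeMeasure d Λ g κ J) (fun (z : ZSite d) (φ : ZSite d → ℝ) => φ z)) n p)
    {n : ℕ} (hn : 2 ≤ n) :
    |(∫ ω, (ω f) ^ (2 * n) ∂(latticeFieldLaw (phi4FreeMeasure d Λ g κ J) Λ δ ρ)) -
        ((2 * n).factorial : ℝ) / (2 ^ n * n.factorial) *
          (∫ ω, (ω f) ^ 2 ∂(latticeFieldLaw (phi4FreeMeasure d Λ g κ J) Λ δ ρ)) ^ n|
      ≤ 3 / 2 * (2 * n : ℝ) ^ 4 *
          (∑ u ∈ Fintype.piFinset (fun _ : Fin 4 => Λ),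
            (∏ j, |ρ * δ ^ d * f (δ • siteToE (u j))|) *
              |connectedFour (phi4FreeMeasure d Λ g κ J)
                (fun (z : ZSite d) (φ : ZSite d → ℝ) => φ z) u|) *
          (((2 * (n - 2)).factorial : ℝ) / (2 ^ (n - 2) * (n - 2).factorial) *
            (∫ ω, (ω h) ^ 2 ∂(latticeFieldLaw (phi4FreeMeasure d Λ g κ J) Λ δ ρ)) ^ (n - 2)) := by
  classical
  -- Step 1: the deviation identity
  rw [integral_pow_sub_wick_eq_sum d Λ hg κ J δ ρ f n]
  -- notation
  set μΛ := phi4FreeMeasure d Λ g κ J with hμΛ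
  set S₂ : ZSite d → ZSite d → ℝ := phi4TwoPointIn d Λ g κ J with hS₂
  set obs : ZSite d → (ZSite d → ℝ) → ℝ := fun z φ => φ z with hobs
  set a : ZSite d → ℝ := fun x => ρ * δ ^ d * f (δ • siteToE x) with ha
  set b : ZSite d → ℝ := fun x => ρ * δ ^ d * h (δ • siteToE x) with hb
  set G : (Fin (2 * n) → ZSite d) → ℝ := fun p => pairingSum S₂ n p with hG
  set U : (Fin 4 → ZSite d) → ℝ := fun u => connectedFour μΛ obs u with hU
  set A : ℝ := ∑ q ∈ Fintype.piFinset (fun _ : Fin (2 * (n - 2)) => Λ),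
    (∏ j, |a (q j)|) * pairingSum S₂ (n - 2) q with hA
  set B : ℝ := ∑ u ∈ Fintype.piFinset (fun _ : Fin 4 => Λ), (∏ j, |a (u j)|) * |U u| with hB
  set W : ℝ := ∫ ω, (ω h) ^ 2 ∂(latticeFieldLaw μΛ Λ δ ρ) with hW'
  have hfac0 : 0 ≤ ((2 * (n - 2)).factorial : ℝ) / (2 ^ (n - 2) * (n - 2).factorial) := by
    positivity
  have hS0 : ∀ x y, 0 ≤ S₂ x y := fun x y => phi4TwoPointIn_nonneg d Λ hg κ hJ x y
  -- the two smeared variances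
  have hWeq : W = ∑ x ∈ Λ, ∑ y ∈ Λ, b x * b y * S₂ x y := by
    rw [hW', integral_sq_eval_latticeFieldLaw_phi4FreeMeasure d Λ hg κ J δ ρ h]
  have hT : ∑ x ∈ Λ, ∑ y ∈ Λ, |a x| * |a y| * S₂ x y ≤ W := by
    rw [hWeq]
    refine Finset.sum_le_sum fun x hx => Finset.sum_le_sum fun y hy => ?_
    refine mul_le_mul_of_nonneg_right ?_ (hS0 x y)
    have hx' := hfh x hx
    have hy' := hfh y hy
    have e1 : |a x| * |a y| = |ρ * δ ^ d| ^ 2 * (|f (δ • siteToE x)| * |f (δ • siteToE y)|) := by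
      simp only [ha, abs_mul]; ring
    have e2 : b x * b y = |ρ * δ ^ d| ^ 2 * (h (δ • siteToE x) * h (δ • siteToE y)) := by
      rw [sq_abs]; simp only [hb]; ring
    rw [e1, e2]
    exact mul_le_mul_of_nonneg_left
      (mul_le_mul hx' hy' (abs_nonneg _) ((abs_nonneg _).trans hx')) (sq_nonneg _)
  have hT0 : 0 ≤ ∑ x ∈ Λ, ∑ y ∈ Λ, |a x| * |a y| * S₂ x y :=
    Finset.sum_nonneg fun x _ => Finset.sum_nonneg fun y _ =>
      mul_nonneg (mul_nonneg (abs_nonneg _) (abs_nonneg _)) (hS0 x y)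
  -- the smeared Wick functional of the remaining points is a Gaussian moment
  have hAeq : A = ((2 * (n - 2)).factorial : ℝ) / (2 ^ (n - 2) * (n - 2).factorial) *
      (∑ x ∈ Λ, ∑ y ∈ Λ, |a x| * |a y| * S₂ x y) ^ (n - 2) :=
    sum_prod_mul_pairingSum Λ (fun x => |a x|) S₂ (n - 2)
  have hA0 : 0 ≤ A := by rw [hAeq]; exact mul_nonneg hfac0 (pow_nonneg hT0 _)
  have hAle : A ≤ ((2 * (n - 2)).factorial : ℝ) / (2 ^ (n - 2) * (n - 2).factorial) * W ^ (n - 2) := by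
    rw [hAeq]
    exact mul_le_mul_of_nonneg_left (pow_le_pow_left₀ hT0 hT _) hfac0
  have hB0 : 0 ≤ B := Finset.sum_nonneg fun u _ =>
    mul_nonneg (Finset.prod_nonneg fun j _ => abs_nonneg _) (abs_nonneg _)
  -- the pointwise bounds on `Λ^{2n}`
  have hdev : ∀ p ∈ Fintype.piFinset (fun _ : Fin (2 * n) => Λ),
      0 ≤ G p - nPoint μΛ obs p ∧
        G p - nPoint μΛ obs p ≤ 3 / 2 * ∑ s : {s : Finset (Fin (2 * n)) // s.card = 4},
          |U (restrictFour p s)| * pairingSum S₂ (n - 2) (removeFour₂ p s) := by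
    intro p hp
    have hpΛ : ∀ i, p i ∈ Λ := fun i => Fintype.mem_piFinset.mp hp i
    refine ⟨sub_nonneg.mpr (phi4Free_nPoint_le_pairingSum d Λ hg κ hJ n p hpΛ), ?_⟩
    have h := hW n hn p hpΛ
    rw [abs_sub_comm] at h
    exact (le_abs_self _).trans h
  -- Step 2: absolute values inside, pointwise bound, factorisation along each 4-subset
  have hsum : |∑ p ∈ Fintype.piFinset (fun _ : Fin (2 * n) => Λ),
      (∏ i, a (p i)) * (nPoint μΛ obs p - G p)| ≤
      3 / 2 * ((Fintype.card {s : Finset (Fin (2 * n)) // s.card = 4} : ℝ) * (A * B)) := by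
    calc |∑ p ∈ Fintype.piFinset (fun _ : Fin (2 * n) => Λ),
          (∏ i, a (p i)) * (nPoint μΛ obs p - G p)|
        ≤ ∑ p ∈ Fintype.piFinset (fun _ : Fin (2 * n) => Λ),
            |(∏ i, a (p i)) * (nPoint μΛ obs p - G p)| := Finset.abs_sum_le_sum_abs _ _
      _ = ∑ p ∈ Fintype.piFinset (fun _ : Fin (2 * n) => Λ),
            (∏ i, |a (p i)|) * (G p - nPoint μΛ obs p) :=
          Finset.sum_congr rfl fun p hp => by
            rw [abs_mul, Finset.abs_prod, ← abs_neg, neg_sub, abs_of_nonneg (hdev p hp).1]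
      _ ≤ ∑ p ∈ Fintype.piFinset (fun _ : Fin (2 * n) => Λ),
            (∏ i, |a (p i)|) * (3 / 2 * ∑ s : {s : Finset (Fin (2 * n)) // s.card = 4},
              |U (restrictFour p s)| * pairingSum S₂ (n - 2) (removeFour₂ p s)) :=
          Finset.sum_le_sum fun p hp => mul_le_mul_of_nonneg_left (hdev p hp).2
            (Finset.prod_nonneg fun i _ => abs_nonneg _)
      _ = 3 / 2 * ∑ s : {s : Finset (Fin (2 * n)) // s.card = 4},
            ∑ p ∈ Fintype.piFinset (fun _ : Fin (2 * n) => Λ),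
              (∏ i, |a (p i)|) *
                ((fun q : Fin (2 * n - 4) → ZSite d =>
                    pairingSum S₂ (n - 2) (q ∘ Fin.cast (two_mul_sub_two n)))
                    (removeFour p s) * (fun u => |U u|) (restrictFour p s)) := by
          rw [Finset.sum_comm, Finset.mul_sum]
          refine Finset.sum_congr rfl fun p _ => ?_
          rw [Finset.mul_sum, Finset.mul_sum, Finset.mul_sum]
          refine Finset.sum_congr rfl fun s _ => ?_
          simp only [removeFour₂]
          ring
      _ = 3 / 2 * ∑ _s : {s : Finset (Fin (2 * n)) // s.card = 4}, A * B := by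
          congr 1
          refine Finset.sum_congr rfl fun s _ => ?_
          rw [sum_prod_mul_removeFour_mul_restrictFour Λ (fun x => |a x|)
            (fun q : Fin (2 * n - 4) → ZSite d =>
              pairingSum S₂ (n - 2) (q ∘ Fin.cast (two_mul_sub_two n)))
            (fun u => |U u|) s,
            sum_piFinset_prod_mul_comp_cast (two_mul_sub_two n) Λ (fun x => |a x|)
              (fun q => pairingSum S₂ (n - 2) q)]
      _ = 3 / 2 * ((Fintype.card {s : Finset (Fin (2 * n)) // s.card = 4} : ℝ) * (A * B)) := by
          rw [Finset.sum_const, Finset.card_univ, nsmul_eq_mul]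
  -- Step 3: `C(2n,4) ≤ (2n)⁴` and `A ≤ (2n-4)!/(2^{n-2}(n-2)!) W^{n-2}`
  have hcard := (card_fourSubsets_le (n := n))
  calc |∑ p ∈ Fintype.piFinset (fun _ : Fin (2 * n) => Λ),
        (∏ i, a (p i)) * (nPoint μΛ obs p - G p)|
      ≤ 3 / 2 * ((Fintype.card {s : Finset (Fin (2 * n)) // s.card = 4} : ℝ) * (A * B)) := hsum
    _ ≤ 3 / 2 * ((2 * n : ℝ) ^ 4 * (A * B)) :=
        mul_le_mul_of_nonneg_left (mul_le_mul_of_nonneg_right hcard (mul_nonneg hA0 hB0))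
          (by norm_num)
    _ = 3 / 2 * (2 * n : ℝ) ^ 4 * B * A := by ring
    _ ≤ 3 / 2 * (2 * n : ℝ) ^ 4 * B *
          (((2 * (n - 2)).factorial : ℝ) / (2 ^ (n - 2) * (n - 2).factorial) * W ^ (n - 2)) :=
        mul_le_mul_of_nonneg_left hAle (mul_nonneg (mul_nonneg (by norm_num) (by positivity)) hB0)

end FiniteVolume

/-! ### Part B. Summation over `n` for exponentially integrable (unbounded) random variables -/

section Summation

/-- The exponential moment of an exponentially integrable random variable is the sum of its
moment series, `E[exp(zX)] = ∑_k z^k E[X^k] / k!` (dominated convergence with the majorant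
`e^{zX} + e^{-zX} ≥ e^{|zX|} ≥ ∑_{k<N} |zX|^k/k!`; the tree's `hasSum_integral_pow_div_factorial`
is the bounded case). [folklore] -/
theorem hasSum_integral_pow_div_factorial_of_integrable_exp {Ω : Type*} [MeasurableSpace Ω]
    (μ : Measure Ω) {X : Ω → ℝ} (hX : Measurable X) (z : ℝ)
    (hpos : Integrable (fun ω => Real.exp (z * X ω)) μ)
    (hneg : Integrable (fun ω => Real.exp (-(z * X ω))) μ) :
    HasSum (fun k : ℕ => z ^ k / k.factorial * ∫ ω, X ω ^ k ∂μ)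
      (∫ ω, Real.exp (z * X ω) ∂μ) := by
  set F : ℕ → Ω → ℝ := fun k ω => (z * X ω) ^ k / k.factorial with hF
  have hFnorm : ∀ k ω, ‖F k ω‖ = |z * X ω| ^ k / k.factorial := fun k ω => by
    rw [hF, Real.norm_eq_abs, abs_div, abs_pow, Nat.abs_cast]
  have hdom : ∀ k ω, ‖F k ω‖ ≤ Real.exp (z * X ω) + Real.exp (-(z * X ω)) := fun k ω => by
    rw [hFnorm]
    have h1 : |z * X ω| ^ k / k.factorial ≤ Real.exp |z * X ω| := by
      have h := Real.sum_le_exp_of_nonneg (abs_nonneg (z * X ω)) (k + 1)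
      rw [Finset.sum_range_succ] at h
      exact (le_add_of_nonneg_left (Finset.sum_nonneg fun i _ => by positivity)).trans h
    exact h1.trans (Real.exp_abs_le _)
  have hFint : ∀ k, Integrable (F k) μ := fun k =>
    (hpos.add hneg).mono' (((hX.const_mul z).pow_const k).div_const _).aestronglyMeasurable
      (Eventually.of_forall (hdom k))
  have hFsum : Summable fun k => ∫ ω, ‖F k ω‖ ∂μ := by
    refine summable_of_sum_range_le (c := ∫ ω, (Real.exp (z * X ω) + Real.exp (-(z * X ω))) ∂μ)
      (fun k => integral_nonneg fun ω => norm_nonneg _) fun N => ?_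
    rw [← integral_finsetSum _ fun k _ => (hFint k).norm]
    refine integral_mono (integrable_finsetSum _ fun k _ => (hFint k).norm) (hpos.add hneg)
      fun ω => ?_
    dsimp only
    calc ∑ k ∈ Finset.range N, ‖F k ω‖ = ∑ k ∈ Finset.range N, |z * X ω| ^ k / k.factorial :=
          Finset.sum_congr rfl fun k _ => hFnorm k ω
      _ ≤ Real.exp |z * X ω| := Real.sum_le_exp_of_nonneg (abs_nonneg _) N
      _ ≤ Real.exp (z * X ω) + Real.exp (-(z * X ω)) := Real.exp_abs_le _
  have h := hasSum_integral_of_summable_integral_norm hFint hFsum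
  have hlim : (fun ω => ∑' k, F k ω) = fun ω => Real.exp (z * X ω) := funext fun ω => by
    rw [Real.exp_eq_exp_ℝ]
    exact (NormedSpace.expSeries_div_hasSum_exp (z * X ω)).tsum_eq
  rw [hlim] at h
  have heq : (fun k => ∫ a, F k a ∂μ) = fun k => z ^ k / k.factorial * ∫ ω, X ω ^ k ∂μ := by
    funext k
    rw [hF]
    dsimp only
    rw [← integral_const_mul]
    refine integral_congr_ae (Eventually.of_forall fun ω => ?_)
    dsimp only
    rw [mul_pow]
    ring
  rw [heq] at h
  exact h

/-- **Summation step for exponentially integrable random variables** (Aizenman–Duminil-Copin 2021,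
§6.3, "Multiplying by `z^{2n}/(2n)!` and summing"; Aizenman CDM 2020, (7.6) ⇒ (7.9)). Let `X` be a
random variable on a probability space with `e^{±zX}` integrable, vanishing odd moments, and even
moments deviating from Wick's law by at most a multiple of the Gaussian `(2n-4)`-th moment of
variance `W`: `|E[X^{2n}] - (2n)!/(2ⁿn!) E[X²]ⁿ| ≤ (2n)⁴ E · (2n-4)!/(2^{n-2}(n-2)!) W^{n-2}` for
`n ≥ 2`. Then `|E[exp(zX)] - exp(z² E[X²]/2)| ≤ 16 E z⁴ exp(z² W/2)` (`(2n)⁴/(2n)! ≤ 16/(2n-4)!`).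
The tree's `abs_mgf_sub_exp_le_of_wickMoment_bounds` (`AizenmanWickBound`) is the same statement for
bounded `X` (Ising spins); the lattice `φ⁴` field is unbounded, with all exponential moments finite.
[cite: AizenmanDuminilCopinAnnals2021, arXiv:1912.07973 §6.3 (p. 26)] [cite: AizenmanCDM2020, §7 eqs. (7.6)–(7.9)] -/
theorem abs_mgf_sub_exp_le_of_wickMoment_bounds_of_integrable_exp {Ω : Type*} [MeasurableSpace Ω]
    {μ : Measure Ω} [IsProbabilityMeasure μ] {X : Ω → ℝ} (hXm : Measurable X) (z : ℝ)
    (hpos : Integrable (fun ω => Real.exp (z * X ω)) μ)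
    (hneg : Integrable (fun ω => Real.exp (-(z * X ω))) μ)
    {E W : ℝ} (hE : 0 ≤ E) (hW : 0 ≤ W)
    (hdev : ∀ n : ℕ, 2 ≤ n →
      |(∫ ω, X ω ^ (2 * n) ∂μ) - ((2 * n).factorial : ℝ) / (2 ^ n * n.factorial) *
          (∫ ω, X ω ^ 2 ∂μ) ^ n|
        ≤ (2 * n : ℝ) ^ 4 * E *
          (((2 * (n - 2)).factorial : ℝ) / (2 ^ (n - 2) * (n - 2).factorial) * W ^ (n - 2)))
    (hodd : ∀ n : ℕ, ∫ ω, X ω ^ (2 * n + 1) ∂μ = 0) :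
    |(∫ ω, Real.exp (z * X ω) ∂μ) - Real.exp (z ^ 2 / 2 * ∫ ω, X ω ^ 2 ∂μ)|
      ≤ 16 * E * z ^ 4 * Real.exp (z ^ 2 / 2 * W) := by
  set V : ℝ := ∫ ω, X ω ^ 2 ∂μ with hV
  set m : ℕ → ℝ := fun k => ∫ ω, X ω ^ k ∂μ with hm
  set w : ℕ → ℝ := fun n => ((2 * n).factorial : ℝ) / (2 ^ n * n.factorial) * W ^ n with hw
  have hm2 : m 2 = V := rfl
  -- even-moment series for the exponential moment of `X`
  have h1 : HasSum (fun k : ℕ => z ^ k / k.factorial * m k) (∫ ω, Real.exp (z * X ω) ∂μ) :=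
    hasSum_integral_pow_div_factorial_of_integrable_exp μ hXm z hpos hneg
  have h2 : HasSum (fun n : ℕ => z ^ (2 * n) / (2 * n).factorial * m (2 * n))
      (∫ ω, Real.exp (z * X ω) ∂μ) := by
    have key := (Function.Injective.hasSum_iff (mul_right_injective₀ (two_ne_zero' ℕ))
      (f := fun k : ℕ => z ^ k / k.factorial * m k) (a := ∫ ω, Real.exp (z * X ω) ∂μ) ?_).mpr h1
    · simpa only [Function.comp_def] using key
    · intro k hk
      rcases Nat.even_or_odd k with ⟨j, hj⟩ | ⟨j, hj⟩
      · exact absurd ⟨j, show 2 * j = k by omega⟩ hk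
      · subst hj
        simp only [hm, hodd j, mul_zero]
  -- the Gaussian series `exp(z² a/2) = ∑ z^{2n}/(2n)! · (2n)!/(2ⁿ n!) aⁿ`
  have hexp2 : ∀ a : ℝ, HasSum (fun n : ℕ => (z ^ 2 / 2 * a) ^ n / n.factorial)
      (Real.exp (z ^ 2 / 2 * a)) := fun a => by
    rw [Real.exp_eq_exp_ℝ]
    exact NormedSpace.expSeries_div_hasSum_exp _
  have hterm : ∀ (a : ℝ) (n : ℕ), z ^ (2 * n) / (2 * n).factorial *
      (((2 * n).factorial : ℝ) / (2 ^ n * n.factorial) * a ^ n)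
      = (z ^ 2 / 2 * a) ^ n / n.factorial := fun a n => by
    have hn : ((2 * n).factorial : ℝ) ≠ 0 := by positivity
    rw [pow_mul, show z ^ 2 / 2 * a = z ^ 2 * a / 2 by ring, div_pow, mul_pow]
    field_simp
  have h3 : HasSum (fun n : ℕ => z ^ (2 * n) / (2 * n).factorial *
      (((2 * n).factorial : ℝ) / (2 ^ n * n.factorial) * V ^ n)) (Real.exp (z ^ 2 / 2 * V)) := by
    simp_rw [hterm V]
    exact hexp2 V
  -- the difference series
  have h4 : HasSum (fun n : ℕ => z ^ (2 * n) / (2 * n).factorial *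
      (m (2 * n) - ((2 * n).factorial : ℝ) / (2 ^ n * n.factorial) * V ^ n))
      ((∫ ω, Real.exp (z * X ω) ∂μ) - Real.exp (z ^ 2 / 2 * V)) := by
    have h4' := h2.sub h3
    simp only [← mul_sub] at h4'
    exact h4'
  -- the Gaussian majorant `z^{2n}/(2n)! w n = (z² W/2)ⁿ/n!`
  have hz2 : ∀ n : ℕ, 0 ≤ z ^ (2 * n) := fun n => by rw [pow_mul]; positivity
  have hw0 : ∀ n, 0 ≤ w n := fun n => by rw [hw]; positivity
  have hc_eq : ∀ n, z ^ (2 * n) / (2 * n).factorial * w n = (z ^ 2 / 2 * W) ^ n / n.factorial :=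
    fun n => by rw [← hterm W n]
  have hc_sum : HasSum (fun n => z ^ (2 * n) / (2 * n).factorial * w n)
      (Real.exp (z ^ 2 / 2 * W)) := by
    simp_rw [hc_eq]
    exact hexp2 W
  -- the shifted majorant `b`
  set b : ℕ → ℝ := fun n => if n < 2 then 0 else
    16 * E * z ^ 4 * (z ^ (2 * (n - 2)) / (2 * (n - 2)).factorial * w (n - 2)) with hb_def
  have hb : HasSum b (16 * E * z ^ 4 * Real.exp (z ^ 2 / 2 * W)) := by
    rw [← hasSum_nat_add_iff' 2]
    have h0 : ∑ i ∈ Finset.range 2, b i = 0 := by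
      simp [hb_def, Finset.sum_range_succ]
    rw [h0, sub_zero]
    have hshift : (fun n => b (n + 2)) =
        fun n => 16 * E * z ^ 4 * (z ^ (2 * n) / (2 * n).factorial * w n) := by
      funext n
      simp [hb_def]
    rw [hshift]
    exact hc_sum.mul_left _
  -- termwise domination
  have hab : ∀ n, |z ^ (2 * n) / (2 * n).factorial *
      (m (2 * n) - ((2 * n).factorial : ℝ) / (2 ^ n * n.factorial) * V ^ n)| ≤ b n := by
    intro n
    rcases lt_or_ge n 2 with hn | hn
    · have h0 : m (2 * n) - ((2 * n).factorial : ℝ) / (2 ^ n * n.factorial) * V ^ n = 0 := by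
        interval_cases n
        · simp [hm]
        · rw [← hm2]
          norm_num [Nat.factorial]
      have hbn : b n = 0 := by rw [hb_def]; exact if_pos hn
      rw [h0, mul_zero, abs_zero, hbn]
    · obtain ⟨k, rfl⟩ : ∃ k, n = k + 2 := ⟨n - 2, by omega⟩
      have hdevn := hdev (k + 2) hn
      have h2n4 : k + 2 - 2 = k := by omega
      rw [h2n4] at hdevn
      have hfacle := Literature.Probability.LatticeModels.two_mul_pow_four_div_factorial_le k
      have hz4 : z ^ (2 * (k + 2)) = z ^ 4 * z ^ (2 * k) := by rw [← pow_add]; ring_nf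
      have hbk : b (k + 2) = 16 * E * z ^ 4 * (z ^ (2 * k) / (2 * k).factorial * w k) := by
        simp [hb_def]
      have hwk : ((2 * k).factorial : ℝ) / (2 ^ k * k.factorial) * W ^ k = w k := rfl
      rw [hwk] at hdevn
      rw [hbk, abs_mul, abs_div, Nat.abs_cast, abs_of_nonneg (hz2 (k + 2))]
      calc z ^ (2 * (k + 2)) / (2 * (k + 2)).factorial *
            |m (2 * (k + 2)) - ((2 * (k + 2)).factorial : ℝ) / (2 ^ (k + 2) * (k + 2).factorial) *
              V ^ (k + 2)|
          ≤ z ^ (2 * (k + 2)) / (2 * (k + 2)).factorial * ((2 * (k + 2 : ℕ) : ℝ) ^ 4 * E * w k) :=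
            mul_le_mul_of_nonneg_left (by exact_mod_cast hdevn)
              (div_nonneg (hz2 _) (by positivity))
        _ = z ^ 4 * ((2 * (k + 2 : ℕ) : ℝ) ^ 4 / (2 * (k + 2)).factorial) *
              (z ^ (2 * k) * E * w k) := by
            rw [hz4]; ring
        _ ≤ z ^ 4 * (16 / (2 * k).factorial) * (z ^ (2 * k) * E * w k) :=
            mul_le_mul_of_nonneg_right
              (mul_le_mul_of_nonneg_left hfacle (by positivity))
              (mul_nonneg (mul_nonneg (hz2 k) hE) (hw0 k))
        _ = 16 * E * z ^ 4 * (z ^ (2 * k) / (2 * k).factorial * w k) := by ring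
  -- conclusion: `|D| ≤ 16 E z⁴ exp(z² W/2)`
  have hup := hasSum_le (fun n => (le_abs_self _).trans (hab n)) h4 hb
  have hlow := hasSum_le (fun n => (neg_le.mpr ((neg_le_abs _).trans (hab n)) : -b n ≤ _)) hb.neg h4
  rw [abs_le]
  exact ⟨by linarith, by linarith⟩

end Summation

/-! ### Part C. Finite-volume inputs for the passage to the thermodynamic limit -/

section FiniteVolumeInputs

variable (d : ℕ)

/-- **First Griffiths inequality for the free-boundary `φ⁴` correlation functions on `ℤᵈ`**:
`0 ≤ S_m^Λ(x) = ⟨∏ᵢ φ_{xᵢ}⟩_Λ` for `g > 0`, `J ≥ 0` (the monomial `∏ᵢ X_{xᵢ}` is ferromagnetic;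
`integral_eval_phi4Measure_nonneg` on the graph `↥Λ`; zero if a point lies outside `Λ`).
[cite: GlimmJaffeQP1987, Thm 4.1.1 (4.1.9) (p. 56)] -/
theorem nPoint_phi4FreeMeasure_nonneg (Λ : Finset (ZSite d)) {g : ℝ} (hg : 0 < g) (κ : ℝ)
    {J : ℝ} (hJ : 0 ≤ J) {m : ℕ} (p : Fin m → ZSite d) :
    0 ≤ nPoint (phi4FreeMeasure d Λ g κ J) (fun (z : ZSite d) (φ : ZSite d → ℝ) => φ z) p := by
  classical
  unfold nPoint
  rw [integral_phi4FreeMeasure d Λ g κ J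
    (Finset.measurable_prod _ fun i _ => measurable_pi_apply (p i))]
  by_cases hp : ∀ i, p i ∈ Λ
  · have heq : ∀ ψ : Λ → ℝ, ∏ i, glueZero Λ ψ (p i) = ∏ i, ψ ⟨p i, hp i⟩ := fun ψ =>
      Finset.prod_congr rfl fun i _ => glueWith_apply_mem _ _ _ (hp i)
    simp_rw [heq]
    have h := integral_eval_phi4Measure_nonneg (zdGraphIn d Λ) hg κ hJ
      (IsFerromagnetic.prod Finset.univ fun i _ =>
        IsFerromagnetic.X (σ := Λ) (⟨p i, hp i⟩ : Λ))
    simpa only [map_prod, MvPolynomial.eval_X] using h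
  · push Not at hp
    obtain ⟨i, hi⟩ := hp
    have heq : ∀ ψ : Λ → ℝ, ∏ i, glueZero Λ ψ (p i) = 0 := fun ψ =>
      Finset.prod_eq_zero (Finset.mem_univ i) (glueWith_apply_not_mem _ _ _ hi)
    simp_rw [heq, integral_zero]
    exact le_rfl

/-- **Even moments of the smeared field are monotone in the modulus of the test function**:
if `|f(δx)| ≤ h(δx)` at the lattice points of `Λ` then `∫ ω(f)^{2m} ≤ ∫ ω(h)^{2m}` under the
free-boundary `φ⁴` law (`g > 0`, `J ≥ 0`): expand both as smeared correlation functions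
(`integral_pow_eval_latticeFieldLaw_phi4FreeMeasure`) and use `S^Λ_{2m} ≥ 0`. [folklore] -/
theorem integral_even_pow_eval_le_of_abs_le (Λ : Finset (ZSite d)) {g : ℝ} (hg : 0 < g) (κ : ℝ)
    {J : ℝ} (hJ : 0 ≤ J) (δ ρ : ℝ) {f h : 𝓢(EuclideanSpace ℝ (Fin d), ℝ)}
    (hfh : ∀ x ∈ Λ, |f (δ • siteToE x)| ≤ h (δ • siteToE x)) (m : ℕ) :
    ∫ ω, (ω f) ^ (2 * m) ∂(latticeFieldLaw (phi4FreeMeasure d Λ g κ J) Λ δ ρ) ≤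
      ∫ ω, (ω h) ^ (2 * m) ∂(latticeFieldLaw (phi4FreeMeasure d Λ g κ J) Λ δ ρ) := by
  classical
  rw [integral_pow_eval_latticeFieldLaw_phi4FreeMeasure d Λ hg κ J δ ρ f (2 * m),
    integral_pow_eval_latticeFieldLaw_phi4FreeMeasure d Λ hg κ J δ ρ h (2 * m)]
  refine Finset.sum_le_sum fun p hp => ?_
  have hpΛ : ∀ i, p i ∈ Λ := fun i => Fintype.mem_piFinset.mp hp i
  have hS0 := nPoint_phi4FreeMeasure_nonneg d Λ hg κ hJ p
  refine mul_le_mul_of_nonneg_right ?_ hS0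
  calc ∏ i, ρ * δ ^ d * f (δ • siteToE (p i)) ≤ |∏ i, ρ * δ ^ d * f (δ • siteToE (p i))| :=
        le_abs_self _
    _ = |ρ * δ ^ d| ^ (2 * m) * ∏ i, |f (δ • siteToE (p i))| := by
        rw [Finset.abs_prod]
        simp_rw [abs_mul (ρ * δ ^ d)]
        rw [Finset.prod_mul_distrib, Finset.prod_const, Finset.card_univ, Fintype.card_fin]
    _ ≤ |ρ * δ ^ d| ^ (2 * m) * ∏ i, h (δ • siteToE (p i)) :=
        mul_le_mul_of_nonneg_left (Finset.prod_le_prod (fun i _ => abs_nonneg _)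
          fun i _ => hfh _ (hpΛ i)) (pow_nonneg (abs_nonneg _) _)
    _ = (ρ * δ ^ d) ^ (2 * m) * ∏ i, h (δ • siteToE (p i)) := by
        rw [pow_mul, sq_abs, ← pow_mul]
    _ = ∏ i, ρ * δ ^ d * h (δ • siteToE (p i)) := by
        rw [Finset.prod_mul_distrib, Finset.prod_const, Finset.card_univ, Fintype.card_fin]

/-- **Odd moments of the smeared free-boundary `φ⁴` field vanish** (evenness: the law does not see
the sign of `ρ`, `latticeFieldLaw_phi4FreeMeasure_neg_rho`, while the smeared field is odd in `ρ`).
This is the "flip symmetry" of Aizenman–Duminil-Copin 2021, §6.3 (p. 26), for the lattice `φ⁴`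
states. [cite: AizenmanDuminilCopinAnnals2021, arXiv:1912.07973 §6.3 (p. 26), "by flip symmetry"] -/
theorem integral_odd_pow_eval_latticeFieldLaw_phi4FreeMeasure (Λ : Finset (ZSite d)) (g κ J δ ρ : ℝ)
    (f : 𝓢(EuclideanSpace ℝ (Fin d), ℝ)) (m : ℕ) :
    ∫ ω, (ω f) ^ (2 * m + 1) ∂(latticeFieldLaw (phi4FreeMeasure d Λ g κ J) Λ δ ρ) = 0 := by
  have hmeas : ∀ ρ' : ℝ, Measurable fun ω : FieldConfig (EuclideanSpace ℝ (Fin d)) =>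
      (ω f) ^ (2 * m + 1) := fun _ => (measurable_eval f).pow_const _
  have hneg : ∀ φ : ZSite d → ℝ, finLatticeField Λ δ (-ρ) φ f = -finLatticeField Λ δ ρ φ f := by
    intro φ
    rw [finLatticeField_apply, finLatticeField_apply, ← Finset.sum_neg_distrib]
    exact Finset.sum_congr rfl fun x _ => by ring
  have h1 : ∫ ω, (ω f) ^ (2 * m + 1) ∂(latticeFieldLaw (phi4FreeMeasure d Λ g κ J) Λ δ (-ρ)) =
      -∫ ω, (ω f) ^ (2 * m + 1) ∂(latticeFieldLaw (phi4FreeMeasure d Λ g κ J) Λ δ ρ) := by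
    rw [integral_latticeFieldLaw d _ Λ δ (-ρ) (hmeas ρ), integral_latticeFieldLaw d _ Λ δ ρ (hmeas ρ),
      ← integral_neg]
    refine integral_congr_ae (Eventually.of_forall fun φ => ?_)
    dsimp only
    rw [hneg, Odd.neg_pow ⟨m, rfl⟩]
  rw [latticeFieldLaw_phi4FreeMeasure_neg_rho] at h1
  linarith

/-- **Uniform Gaussian bounds on the even moments along the thermodynamic limit.** If the box laws
converge in law as `R → ∞` (`g > 0`, `J ≥ 0`, `δ ≥ 0`, `ρ ≥ 0`) and `h ≥ 0` at the lattice points,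
then for every `m` the moments `∫ ω(h)^{2m} d(law_R)` are eventually bounded (Newman's inequality in
each box, `latticeFieldLaw_phi4Box_integral_pow_le`, and the eventual variance bound
`phi4_thermodynamicLimit_variance_bounded`). [folklore] -/
theorem phi4_thermodynamicLimit_even_moment_bounded {g κ J δ ρ : ℝ} (hg : 0 < g) (hJ : 0 ≤ J)
    (hδ : 0 ≤ δ) (hρ : 0 ≤ ρ) {ν : Measure (FieldConfig (EuclideanSpace ℝ (Fin d)))}
    (hν : TendstoInLaw (fun R : ℕ =>
        latticeFieldLaw (phi4BoxMeasure d R g κ J) (box d R) δ ρ) atTop ν)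
    {h : 𝓢(EuclideanSpace ℝ (Fin d), ℝ)} (hh : ∀ x : ZSite d, 0 ≤ h (δ • siteToE x)) (m : ℕ) :
    ∃ B : ℝ, ∀ᶠ R : ℕ in atTop,
      ∫ ω, (ω h) ^ (2 * m) ∂(latticeFieldLaw (phi4BoxMeasure d R g κ J) (box d R) δ ρ) ≤ B := by
  obtain ⟨B, hB⟩ := phi4_thermodynamicLimit_variance_bounded hg hJ hδ hν hh
  refine ⟨((2 * m).factorial : ℝ) / (2 ^ m * m.factorial) * (max B 0) ^ m, ?_⟩
  filter_upwards [hB] with R hR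
  have hv0 : 0 ≤ ∫ ω, (ω h) ^ 2 ∂(latticeFieldLaw (phi4BoxMeasure d R g κ J) (box d R) δ ρ) :=
    integral_nonneg fun _ => sq_nonneg _
  refine (latticeFieldLaw_phi4Box_integral_pow_le d R hg κ hJ hδ hρ (fun x _ => hh x) m).trans ?_
  exact mul_le_mul_of_nonneg_left (pow_le_pow_left₀ hv0 (hR.trans (le_max_left _ _)) m)
    (by positivity)

end FiniteVolumeInputs

/-! ### Part D. One mesh: the exponential-moment deviation for the thermodynamic-limit laws -/

section OneMesh

variable (d : ℕ)

/-- Part A in the box vocabulary of the tree's `phi44_triviality` (`phi4BoxMeasure d R`,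
`phi4TwoPointBox d R`, definitionally the free-boundary objects of the volume `box d R`). [cite: AizenmanDuminilCopinAnnals2021, arXiv:1912.07973 §6.3 (p. 26) with §7 (p. 28)] -/
theorem abs_integral_pow_sub_wick_le_box (R : ℕ) {g : ℝ} (hg : 0 < g) (κ : ℝ) {J : ℝ}
    (hJ : 0 ≤ J) (δ ρ : ℝ) {f h : 𝓢(EuclideanSpace ℝ (Fin d), ℝ)}
    (hfh : ∀ x ∈ box d R, |f (δ • siteToE x)| ≤ h (δ • siteToE x))
    (hW : ∀ n : ℕ, 2 ≤ n → ∀ p : Fin (2 * n) → ZSite d, (∀ i, p i ∈ box d R) →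
      |nPoint (phi4BoxMeasure d R g κ J) (fun (z : ZSite d) (φ : ZSite d → ℝ) => φ z) p -
          pairingSum (phi4TwoPointBox d R g κ J) n p| ≤
        3 / 2 * wickRemainder (phi4TwoPointBox d R g κ J)
          (connectedFour (phi4BoxMeasure d R g κ J) (fun (z : ZSite d) (φ : ZSite d → ℝ) => φ z)) n p)
    {n : ℕ} (hn : 2 ≤ n) :
    |(∫ ω, (ω f) ^ (2 * n) ∂(latticeFieldLaw (phi4BoxMeasure d R g κ J) (box d R) δ ρ)) -
        ((2 * n).factorial : ℝ) / (2 ^ n * n.factorial) *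
          (∫ ω, (ω f) ^ 2 ∂(latticeFieldLaw (phi4BoxMeasure d R g κ J) (box d R) δ ρ)) ^ n|
      ≤ 3 / 2 * (2 * n : ℝ) ^ 4 *
          (∑ u ∈ Fintype.piFinset (fun _ : Fin 4 => box d R),
            (∏ j, |ρ * δ ^ d * f (δ • siteToE (u j))|) *
              |connectedFour (phi4BoxMeasure d R g κ J)
                (fun (z : ZSite d) (φ : ZSite d → ℝ) => φ z) u|) *
          (((2 * (n - 2)).factorial : ℝ) / (2 ^ (n - 2) * (n - 2).factorial) *
            (∫ ω, (ω h) ^ 2 ∂(latticeFieldLaw (phi4BoxMeasure d R g κ J) (box d R) δ ρ)) ^ (n - 2)) :=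
  abs_integral_pow_sub_wick_le d (box d R) hg κ hJ δ ρ hfh hW hn

/-- **The Wick sandwich passes to the thermodynamic limit and sums to an exponential-moment
bound** (Aizenman–Duminil-Copin 2021, §6.3 for the `φ⁴` states of §7, at the level of the
restated `phi44_triviality`: one mesh `δ`, the limit in law `ν` of the free-boundary box laws as
`R → ∞`). Data: `g > 0`, `J ≥ 0`, `δ ≥ 0`, `ρ ≥ 0`; the upper half of the Wick sandwich in every
box (hypothesis `hW`, Aizenman's Prop. 12.1 for the box states); a compactly supported test
function `f`, a lattice-pointwise majorant `h ≥ |f|` and a reference test function `χ ≥ 0`; and,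
eventually in `R`, a bound `𝔘_R(f) ≤ E ⟨ω(χ)²⟩_R²` on the smeared `|U₄|`-sum and a variance
comparison `⟨ω(h)²⟩_R ≤ C ⟨ω(χ)²⟩_R`. Then, with `s = ∫ ω(χ)² dν`,
`|∫ e^{wω(f)} dν - e^{w² ∫ω(f)² dν/2}| ≤ 16 · (3/2) E s² · w⁴ · e^{w² C s/2}` for every real `w`:
the moments of `ω(f)` under the box laws converge to those under `ν` (uniform Gaussian bounds through
`h`), odd ones vanish, the finite-volume deviation bound (`abs_integral_pow_sub_wick_le_box`)
passes to the limit, and the summation is `abs_mgf_sub_exp_le_of_wickMoment_bounds_of_integrable_exp`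
(all exponential moments of `ω(f)` under `ν` are finite, `phi4_thermodynamicLimit_integrable_exp`).
[cite: AizenmanDuminilCopinAnnals2021, arXiv:1912.07973 §6.3 (p. 26), Prop. 7.2 (p. 28)] -/
theorem abs_mgf_sub_exp_le_of_thermodynamicLimit {g κ J δ ρ : ℝ} (hg : 0 < g) (hJ : 0 ≤ J)
    (hδ : 0 ≤ δ) (hρ : 0 ≤ ρ) {ν : Measure (FieldConfig (EuclideanSpace ℝ (Fin d)))}
    (hν : TendstoInLaw (fun R : ℕ =>
        latticeFieldLaw (phi4BoxMeasure d R g κ J) (box d R) δ ρ) atTop ν)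
    (hW : ∀ (R : ℕ) (n : ℕ), 2 ≤ n → ∀ p : Fin (2 * n) → ZSite d, (∀ i, p i ∈ box d R) →
      |nPoint (phi4BoxMeasure d R g κ J) (fun (z : ZSite d) (φ : ZSite d → ℝ) => φ z) p -
          pairingSum (phi4TwoPointBox d R g κ J) n p| ≤
        3 / 2 * wickRemainder (phi4TwoPointBox d R g κ J)
          (connectedFour (phi4BoxMeasure d R g κ J) (fun (z : ZSite d) (φ : ZSite d → ℝ) => φ z)) n p)
    {f h χ : 𝓢(EuclideanSpace ℝ (Fin d), ℝ)} (hf : HasCompactSupport f)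
    (hh : ∀ x : ZSite d, 0 ≤ h (δ • siteToE x)) (hχ : ∀ x : ZSite d, 0 ≤ χ (δ • siteToE x))
    (hfh : ∀ x : ZSite d, |f (δ • siteToE x)| ≤ h (δ • siteToE x))
    {E C : ℝ} (hE : 0 ≤ E) (hC : 0 ≤ C)
    (hUev : ∀ᶠ R : ℕ in atTop,
      (∑ u ∈ Fintype.piFinset (fun _ : Fin 4 => box d R),
          (∏ j, |ρ * δ ^ d * f (δ • siteToE (u j))|) *
            |connectedFour (phi4BoxMeasure d R g κ J)
              (fun (z : ZSite d) (φ : ZSite d → ℝ) => φ z) u|) ≤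
        E * (∫ ω, (ω χ) ^ 2 ∂(latticeFieldLaw (phi4BoxMeasure d R g κ J) (box d R) δ ρ)) ^ 2)
    (hBev : ∀ᶠ R : ℕ in atTop,
      ∫ ω, (ω h) ^ 2 ∂(latticeFieldLaw (phi4BoxMeasure d R g κ J) (box d R) δ ρ) ≤
        C * ∫ ω, (ω χ) ^ 2 ∂(latticeFieldLaw (phi4BoxMeasure d R g κ J) (box d R) δ ρ))
    (w : ℝ) :
    |(∫ ω, Real.exp (w * ω f) ∂ν) - Real.exp (w ^ 2 / 2 * ∫ ω, (ω f) ^ 2 ∂ν)| ≤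
      16 * (3 / 2 * E * (∫ ω, (ω χ) ^ 2 ∂ν) ^ 2) * w ^ 4 *
        Real.exp (w ^ 2 / 2 * (C * ∫ ω, (ω χ) ^ 2 ∂ν)) := by
  set law : ℕ → Measure (FieldConfig (EuclideanSpace ℝ (Fin d))) := fun R =>
    latticeFieldLaw (phi4BoxMeasure d R g κ J) (box d R) δ ρ with hlaw
  have hprobR : ∀ R : ℕ, IsProbabilityMeasure (law R) := fun R => by
    haveI := isProbabilityMeasure_phi4BoxMeasure d R hg κ J
    simp only [hlaw]
    infer_instance
  have hprob : ∀ᶠ R in atTop, IsProbabilityMeasure (law R) := Eventually.of_forall hprobR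
  haveI : IsProbabilityMeasure ν := isProbabilityMeasure_of_tendstoInLaw hprob hν
  set s : ℝ := ∫ ω, (ω χ) ^ 2 ∂ν with hs
  -- the variances of `χ` and `h` converge
  obtain ⟨-, -, hχlim, -⟩ := phi4_thermodynamicLimit_gaussianDomination hg hJ hδ hν hχ
  obtain ⟨-, -, hhlim, -⟩ := phi4_thermodynamicLimit_gaussianDomination hg hJ hδ hν hh
  have hBle : ∫ ω, (ω h) ^ 2 ∂ν ≤ C * s := le_of_tendsto_of_tendsto hhlim (hχlim.const_mul C) hBev
  have hB0 : 0 ≤ ∫ ω, (ω h) ^ 2 ∂ν := integral_nonneg fun _ => sq_nonneg _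
  have hs0 : 0 ≤ s := integral_nonneg fun _ => sq_nonneg _
  -- all moments of `ω(f)` converge along the thermodynamic limit
  have hmomf : ∀ m : ℕ, Tendsto (fun R => ∫ ω, (ω f) ^ m ∂(law R)) atTop
      (𝓝 (∫ ω, (ω f) ^ m ∂ν)) := by
    intro m
    obtain ⟨Bm, hBm⟩ := phi4_thermodynamicLimit_even_moment_bounded d hg hJ hδ hρ hν hh m
    refine (tendsto_integral_pow_eval_of_tendstoInLaw hprob hν f m (B := Bm) ?_).2
    filter_upwards [hBm] with R hR
    exact ⟨integrable_pow_eval_latticeFieldLaw_phi4FreeMeasure d (box d R) hg κ J δ ρ f (2 * m),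
      (integral_even_pow_eval_le_of_abs_le d (box d R) hg κ hJ δ ρ (fun x _ => hfh x) m).trans hR⟩
  -- odd moments of `ω(f)` under `ν` vanish
  have hodd : ∀ m : ℕ, ∫ ω, (ω f) ^ (2 * m + 1) ∂ν = 0 := fun m =>
    tendsto_nhds_unique (hmomf (2 * m + 1))
      (tendsto_const_nhds.congr fun R =>
        (integral_odd_pow_eval_latticeFieldLaw_phi4FreeMeasure d (box d R) g κ J δ ρ f m).symm)
  -- the deviation from Wick's law under `ν`
  have hdev : ∀ n : ℕ, 2 ≤ n →
      |(∫ ω, (ω f) ^ (2 * n) ∂ν) - ((2 * n).factorial : ℝ) / (2 ^ n * n.factorial) *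
          (∫ ω, (ω f) ^ 2 ∂ν) ^ n|
        ≤ (2 * n : ℝ) ^ 4 * (3 / 2 * E * s ^ 2) *
          (((2 * (n - 2)).factorial : ℝ) / (2 ^ (n - 2) * (n - 2).factorial) *
            (C * s) ^ (n - 2)) := by
    intro n hn
    have hfac0 : 0 ≤ ((2 * (n - 2)).factorial : ℝ) / (2 ^ (n - 2) * (n - 2).factorial) := by
      positivity
    have hlhs : Tendsto (fun R => (∫ ω, (ω f) ^ (2 * n) ∂(law R)) -
        ((2 * n).factorial : ℝ) / (2 ^ n * n.factorial) * (∫ ω, (ω f) ^ 2 ∂(law R)) ^ n) atTop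
        (𝓝 ((∫ ω, (ω f) ^ (2 * n) ∂ν) - ((2 * n).factorial : ℝ) / (2 ^ n * n.factorial) *
          (∫ ω, (ω f) ^ 2 ∂ν) ^ n)) :=
      (hmomf (2 * n)).sub (((hmomf 2).pow n).const_mul _)
    have hrhs : Tendsto (fun R => 3 / 2 * (2 * n : ℝ) ^ 4 *
        (E * (∫ ω, (ω χ) ^ 2 ∂(law R)) ^ 2) *
        (((2 * (n - 2)).factorial : ℝ) / (2 ^ (n - 2) * (n - 2).factorial) *
          (C * ∫ ω, (ω χ) ^ 2 ∂(law R)) ^ (n - 2))) atTop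
        (𝓝 (3 / 2 * (2 * n : ℝ) ^ 4 * (E * s ^ 2) *
          (((2 * (n - 2)).factorial : ℝ) / (2 ^ (n - 2) * (n - 2).factorial) *
            (C * s) ^ (n - 2)))) :=
      (((hχlim.pow 2).const_mul E).const_mul _).mul
        (((hχlim.const_mul C).pow (n - 2)).const_mul _)
    have hle : ∀ᶠ R in atTop, |(∫ ω, (ω f) ^ (2 * n) ∂(law R)) -
        ((2 * n).factorial : ℝ) / (2 ^ n * n.factorial) * (∫ ω, (ω f) ^ 2 ∂(law R)) ^ n| ≤
        3 / 2 * (2 * n : ℝ) ^ 4 * (E * (∫ ω, (ω χ) ^ 2 ∂(law R)) ^ 2) *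
          (((2 * (n - 2)).factorial : ℝ) / (2 ^ (n - 2) * (n - 2).factorial) *
            (C * ∫ ω, (ω χ) ^ 2 ∂(law R)) ^ (n - 2)) := by
      filter_upwards [hUev, hBev] with R hUR hBR
      have key := abs_integral_pow_sub_wick_le_box d R hg κ hJ δ ρ (f := f) (h := h)
        (fun x _ => hfh x) (hW R) hn
      refine key.trans ?_
      have hW0 : 0 ≤ ∫ ω, (ω h) ^ 2 ∂(law R) := integral_nonneg fun _ => sq_nonneg _
      have hpow : (∫ ω, (ω h) ^ 2 ∂(law R)) ^ (n - 2) ≤ (C * ∫ ω, (ω χ) ^ 2 ∂(law R)) ^ (n - 2) :=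
        pow_le_pow_left₀ hW0 hBR _
      have hU0 : 0 ≤ ∑ u ∈ Fintype.piFinset (fun _ : Fin 4 => box d R),
          (∏ j, |ρ * δ ^ d * f (δ • siteToE (u j))|) *
            |connectedFour (phi4BoxMeasure d R g κ J)
              (fun (z : ZSite d) (φ : ZSite d → ℝ) => φ z) u| :=
        Finset.sum_nonneg fun u _ =>
          mul_nonneg (Finset.prod_nonneg fun j _ => abs_nonneg _) (abs_nonneg _)
      have h32 : 0 ≤ 3 / 2 * (2 * n : ℝ) ^ 4 := by positivity
      exact mul_le_mul (mul_le_mul_of_nonneg_left hUR h32)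
        (mul_le_mul_of_nonneg_left hpow hfac0) (mul_nonneg hfac0 (pow_nonneg hW0 _))
        (mul_nonneg h32 (mul_nonneg hE (sq_nonneg _)))
    have hlim := le_of_tendsto_of_tendsto hlhs.abs hrhs hle
    refine hlim.trans (le_of_eq ?_)
    ring
  -- all exponential moments of `ω(f)` under `ν` are finite; summation over `n`
  have hexp := fun w' : ℝ => phi4_thermodynamicLimit_integrable_exp hg hJ hδ hν f hf w'
  have hneg : Integrable (fun ω : FieldConfig (EuclideanSpace ℝ (Fin d)) =>
      Real.exp (-(w * ω f))) ν := by
    simpa only [neg_mul] using hexp (-w)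
  exact abs_mgf_sub_exp_le_of_wickMoment_bounds_of_integrable_exp (measurable_eval f) w (hexp w)
    hneg (by positivity) (mul_nonneg hC hs0) hdev hodd

end OneMesh

/-! ### Part E. Lattice bookkeeping for the scaling window -/

section Bookkeeping

variable (d : ℕ)

/-- A Schwartz **plateau function**: compactly supported, `≥ 0`, and `≥ 1` on the cube `[-1,1]ᵈ`
(a `ContDiffBump` centred at `0` with inner radius `d + 1 ≥ √d`). [folklore] -/
theorem exists_schwartz_plateau :
    ∃ χ : 𝓢(EuclideanSpace ℝ (Fin d), ℝ), HasCompactSupport χ ∧ (∀ y, 0 ≤ χ y) ∧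
      ∀ y : EuclideanSpace ℝ (Fin d), (∀ i, |y i| ≤ 1) → 1 ≤ χ y := by
  let b : ContDiffBump (0 : EuclideanSpace ℝ (Fin d)) :=
    ⟨d + 1, d + 2, by positivity, by linarith⟩
  have hbs : HasCompactSupport (b : EuclideanSpace ℝ (Fin d) → ℝ) := b.hasCompactSupport
  have hbd : ContDiff ℝ ((⊤ : ℕ∞) : WithTop ℕ∞) (b : EuclideanSpace ℝ (Fin d) → ℝ) := b.contDiff
  refine ⟨hbs.toSchwartzMap hbd, hbs, fun y => b.nonneg, fun y hy => le_of_eq ?_⟩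
  refine (b.one_of_mem_closedBall ?_).symm
  rw [Metric.mem_closedBall, dist_zero_right, EuclideanSpace.norm_eq]
  have hsum : ∑ i, ‖y i‖ ^ 2 ≤ (d : ℝ) := by
    calc ∑ i, ‖y i‖ ^ 2 ≤ ∑ _i : Fin d, (1 : ℝ) := Finset.sum_le_sum fun i _ => by
            rw [Real.norm_eq_abs]
            nlinarith [hy i, abs_nonneg (y i)]
      _ = d := by simp
  calc Real.sqrt (∑ i, ‖y i‖ ^ 2) ≤ Real.sqrt d := Real.sqrt_le_sqrt hsum
    _ ≤ (d : ℝ) + 1 := by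
        nlinarith [Real.sq_sqrt (Nat.cast_nonneg d), Real.sqrt_nonneg (d : ℝ),
          sq_nonneg (Real.sqrt d - 1)]

/-- A compactly supported test function vanishes outside a cube `[-r, r]ᵈ` with `r ≥ 1`. [folklore] -/
theorem exists_cube_of_hasCompactSupport (f : 𝓢(EuclideanSpace ℝ (Fin d), ℝ))
    (hf : HasCompactSupport f) :
    ∃ r : ℝ, 1 ≤ r ∧ ∀ y : EuclideanSpace ℝ (Fin d), f y ≠ 0 → ∀ i, |y i| ≤ r := by
  obtain ⟨r₀, hr₀⟩ := hf.isCompact.isBounded.subset_closedBall (0 : EuclideanSpace ℝ (Fin d))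
  refine ⟨max r₀ 1, le_max_right _ _, fun y hy i => ?_⟩
  have hy' : y ∈ Metric.closedBall (0 : EuclideanSpace ℝ (Fin d)) r₀ :=
    hr₀ (subset_tsupport _ (Function.mem_support.mpr hy))
  rw [Metric.mem_closedBall, dist_zero_right] at hy'
  calc |y i| = ‖y i‖ := (Real.norm_eq_abs _).symm
    _ ≤ ‖y‖ := PiLp.norm_apply_le y i
    _ ≤ r₀ := hy'
    _ ≤ max r₀ 1 := le_max_left _ _

/-- A compactly supported test function is bounded. [folklore] -/
theorem exists_abs_le_of_hasCompactSupport (f : 𝓢(EuclideanSpace ℝ (Fin d), ℝ))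
    (hf : HasCompactSupport f) : ∃ M : ℝ, 0 ≤ M ∧ ∀ y, |f y| ≤ M := by
  obtain ⟨C, hC⟩ := hf.exists_bound_of_continuous f.continuous
  exact ⟨max C 0, le_max_right _ _, fun y =>
    (Real.norm_eq_abs _).symm.le.trans ((hC y).trans (le_max_left _ _))⟩

/-- Lattice points where a scaled test function supported in `[-r,r]ᵈ` is nonzero lie in
`Λ_{r/δ}` (`δ > 0`). [folklore] -/
theorem mem_latticeBox_of_apply_ne_zero {δ r : ℝ} (hδ : 0 < δ)
    {f : 𝓢(EuclideanSpace ℝ (Fin d), ℝ)}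
    (hfr : ∀ y : EuclideanSpace ℝ (Fin d), f y ≠ 0 → ∀ i, |y i| ≤ r) {x : ZSite d}
    (hx : f (δ • siteToE x) ≠ 0) : x ∈ latticeBox d (r / δ) := by
  rw [mem_latticeBox]
  intro i
  have h := hfr _ hx i
  rw [PiLp.smul_apply, siteToE_apply, smul_eq_mul, abs_mul, abs_of_pos hδ] at h
  rw [le_div_iff₀ hδ, mul_comm]
  exact h

/-- `Λ_L ⊆ box d R` once `R ≥ L`. [folklore] -/
theorem latticeBox_subset_box {L : ℝ} {R : ℕ} (h : L ≤ R) : latticeBox d L ⊆ box d R := by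
  intro x hx
  rw [mem_box]
  intro i
  have h1 : |((x i : ℤ) : ℝ)| ≤ R := (mem_latticeBox.1 hx i).trans h
  rw [abs_le] at h1
  constructor
  · exact_mod_cast h1.1
  · exact_mod_cast h1.2

/-- **Truncating a weighted sum to the support of the weights** (one variable): if `|w| ≤ W`,
`w = 0` off `B` and `g ≥ 0`, then `∑_{a ∈ A} |w a| g a ≤ W ∑_{a ∈ B} g a`. [folklore] -/
theorem sum_abs_mul_le_of_support {α : Type*} [DecidableEq α] (A B : Finset α) {w : α → ℝ}
    {W : ℝ} (hW : 0 ≤ W) (hw : ∀ a, |w a| ≤ W) (hwB : ∀ a, a ∉ B → w a = 0) {g : α → ℝ}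
    (hg : ∀ a, 0 ≤ g a) :
    ∑ a ∈ A, |w a| * g a ≤ W * ∑ a ∈ B, g a := by
  calc ∑ a ∈ A, |w a| * g a = ∑ a ∈ A.filter (· ∈ B), |w a| * g a := by
        rw [Finset.sum_filter_of_ne]
        intro a _ hne
        by_contra haB
        exact hne (by rw [hwB a haB, abs_zero, zero_mul])
    _ ≤ ∑ a ∈ A.filter (· ∈ B), W * g a :=
        Finset.sum_le_sum fun a _ => mul_le_mul_of_nonneg_right (hw a) (hg a)
    _ ≤ ∑ a ∈ B, W * g a :=
        Finset.sum_le_sum_of_subset_of_nonneg (fun a ha => (Finset.mem_filter.1 ha).2)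
          fun a _ _ => mul_nonneg hW (hg a)
    _ = W * ∑ a ∈ B, g a := (Finset.mul_sum _ _ _).symm

/-- **Truncating the smeared `|U₄|`-sum to the support of the test function**: if `|w| ≤ W`
and `w = 0` off `B`, then `∑_{u ∈ A⁴} (∏ⱼ |w(uⱼ)|) |U(u)| ≤ W⁴ ∑_{u ∈ B⁴} |U(u)|`. [folklore] -/
theorem sum_prod_abs_mul_abs_le_of_support {α : Type*} [DecidableEq α] (A B : Finset α)
    {w : α → ℝ} {W : ℝ} (hW : 0 ≤ W) (hw : ∀ a, |w a| ≤ W) (hwB : ∀ a, a ∉ B → w a = 0)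
    (U : (Fin 4 → α) → ℝ) :
    ∑ u ∈ Fintype.piFinset (fun _ : Fin 4 => A), (∏ j, |w (u j)|) * |U u| ≤
      W ^ 4 * ∑ u ∈ Fintype.piFinset (fun _ : Fin 4 => B), |U u| := by
  calc ∑ u ∈ Fintype.piFinset (fun _ : Fin 4 => A), (∏ j, |w (u j)|) * |U u|
      = ∑ u ∈ (Fintype.piFinset (fun _ : Fin 4 => A)).filter
          (· ∈ Fintype.piFinset (fun _ : Fin 4 => B)), (∏ j, |w (u j)|) * |U u| := by
        rw [Finset.sum_filter_of_ne]
        intro u _ hne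
        by_contra huB
        rw [Fintype.mem_piFinset] at huB
        push Not at huB
        obtain ⟨j, hj⟩ := huB
        exact hne (by rw [Finset.prod_eq_zero (Finset.mem_univ j)
          (by rw [hwB _ hj, abs_zero]), zero_mul])
    _ ≤ ∑ u ∈ (Fintype.piFinset (fun _ : Fin 4 => A)).filter
          (· ∈ Fintype.piFinset (fun _ : Fin 4 => B)), W ^ 4 * |U u| :=
        Finset.sum_le_sum fun u _ => mul_le_mul_of_nonneg_right
          (by
            calc ∏ j, |w (u j)| ≤ ∏ _j : Fin 4, W :=
                  Finset.prod_le_prod (fun j _ => abs_nonneg _) fun j _ => hw _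
              _ = W ^ 4 := by rw [Finset.prod_const, Finset.card_univ, Fintype.card_fin])
          (abs_nonneg _)
    _ ≤ ∑ u ∈ Fintype.piFinset (fun _ : Fin 4 => B), W ^ 4 * |U u| :=
        Finset.sum_le_sum_of_subset_of_nonneg (fun u hu => (Finset.mem_filter.1 hu).2)
          fun u _ _ => mul_nonneg (pow_nonneg hW 4) (abs_nonneg _)
    _ = W ^ 4 * ∑ u ∈ Fintype.piFinset (fun _ : Fin 4 => B), |U u| := (Finset.mul_sum _ _ _).symm

/-- **Upper bound for a smeared two-point sum by truncation**: `|w| ≤ W`, `w = 0` off `B`,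
`S ≥ 0` give `∑_{x,y ∈ A} w(x) w(y) S(x,y) ≤ W² ∑_{x,y ∈ B} S(x,y)`. [folklore] -/
theorem sum_sum_mul_mul_le_of_support {α : Type*} [DecidableEq α] (A B : Finset α) {w : α → ℝ}
    {W : ℝ} (hW : 0 ≤ W) (hw : ∀ a, |w a| ≤ W) (hwB : ∀ a, a ∉ B → w a = 0) {S : α → α → ℝ}
    (hS : ∀ x y, 0 ≤ S x y) :
    ∑ x ∈ A, ∑ y ∈ A, w x * w y * S x y ≤ W ^ 2 * ∑ x ∈ B, ∑ y ∈ B, S x y := by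
  calc ∑ x ∈ A, ∑ y ∈ A, w x * w y * S x y
      ≤ ∑ x ∈ A, |w x| * ∑ y ∈ A, |w y| * S x y := by
        refine Finset.sum_le_sum fun x _ => ?_
        rw [Finset.mul_sum]
        refine Finset.sum_le_sum fun y _ => ?_
        calc w x * w y * S x y ≤ |w x * w y * S x y| := le_abs_self _
          _ = |w x| * (|w y| * S x y) := by rw [abs_mul, abs_mul, abs_of_nonneg (hS x y), mul_assoc]
    _ ≤ ∑ x ∈ A, |w x| * (W * ∑ y ∈ B, S x y) :=
        Finset.sum_le_sum fun x _ => mul_le_mul_of_nonneg_left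
          (sum_abs_mul_le_of_support A B hW hw hwB (hS x)) (abs_nonneg _)
    _ = W * ∑ x ∈ A, |w x| * ∑ y ∈ B, S x y := by
        rw [Finset.mul_sum]
        exact Finset.sum_congr rfl fun x _ => by ring
    _ ≤ W * (W * ∑ x ∈ B, ∑ y ∈ B, S x y) :=
        mul_le_mul_of_nonneg_left
          (sum_abs_mul_le_of_support A B hW hw hwB fun x => Finset.sum_nonneg fun y _ => hS x y) hW
    _ = W ^ 2 * ∑ x ∈ B, ∑ y ∈ B, S x y := by ring

/-- **Lower bound for a smeared two-point sum by a plateau**: for `Λ ⊆ A`, weights `w ≥ 0` on `A`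
with `w ≥ c ≥ 0` on `Λ`, and `S ≥ 0`: `c² ∑_{x,y ∈ Λ} S(x,y) ≤ ∑_{x,y ∈ A} w(x) w(y) S(x,y)`.
[folklore] -/
theorem mul_sum_sum_le_of_plateau {α : Type*} (Λ A : Finset α) (hΛA : Λ ⊆ A) {w : α → ℝ}
    {c : ℝ} (hc : 0 ≤ c) (hwA : ∀ a ∈ A, 0 ≤ w a) (hwΛ : ∀ a ∈ Λ, c ≤ w a) {S : α → α → ℝ}
    (hS : ∀ x y, 0 ≤ S x y) :
    c ^ 2 * ∑ x ∈ Λ, ∑ y ∈ Λ, S x y ≤ ∑ x ∈ A, ∑ y ∈ A, w x * w y * S x y := by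
  calc c ^ 2 * ∑ x ∈ Λ, ∑ y ∈ Λ, S x y = ∑ x ∈ Λ, ∑ y ∈ Λ, c * c * S x y := by
        rw [Finset.mul_sum]
        refine Finset.sum_congr rfl fun x _ => ?_
        rw [Finset.mul_sum]
        exact Finset.sum_congr rfl fun y _ => by ring
    _ ≤ ∑ x ∈ Λ, ∑ y ∈ Λ, w x * w y * S x y :=
        Finset.sum_le_sum fun x hx => Finset.sum_le_sum fun y hy =>
          mul_le_mul_of_nonneg_right (mul_le_mul (hwΛ x hx) (hwΛ y hy) hc
            (hc.trans (hwΛ x hx))) (hS x y)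
    _ ≤ ∑ x ∈ Λ, ∑ y ∈ A, w x * w y * S x y :=
        Finset.sum_le_sum fun x hx => Finset.sum_le_sum_of_subset_of_nonneg hΛA
          fun y hy _ => mul_nonneg (mul_nonneg (hwA x (hΛA hx)) (hwA y hy)) (hS x y)
    _ ≤ ∑ x ∈ A, ∑ y ∈ A, w x * w y * S x y :=
        Finset.sum_le_sum_of_subset_of_nonneg hΛA fun x hx _ =>
          Finset.sum_nonneg fun y hy => mul_nonneg (mul_nonneg (hwA x hx) (hwA y hy)) (hS x y)

/-- The law of the smeared box field does not see the sign of `ρ`: `law(|ρ|) = law(ρ)`. [folklore] -/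
theorem latticeFieldLaw_phi4BoxMeasure_abs_rho (R : ℕ) (g κ J δ ρ : ℝ) :
    latticeFieldLaw (phi4BoxMeasure d R g κ J) (box d R) δ |ρ| =
      latticeFieldLaw (phi4BoxMeasure d R g κ J) (box d R) δ ρ := by
  rcases le_or_gt 0 ρ with hρ | hρ
  · rw [abs_of_nonneg hρ]
  · rw [abs_of_neg hρ, latticeFieldLaw_phi4BoxMeasure_neg_rho]

end Bookkeeping

/-! ### Part F. The two eventual finite-volume inputs at one mesh -/

section MeshInputs

variable (d : ℕ)

/-- **The smeared `|U₄|`-sum at mesh `δ` is controlled by the printed `U₄`-sum.** If, eventually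
in the volume `R`, `∑_{u ∈ Λ_{r_f/δ}⁴} |U₄^R(u)| ≤ A (∑_{x,y ∈ Λ_L} S₂^R(x,y))²` for some `L ≤ 1/δ`,
then eventually `𝔘_R(f) = ∑_{u ∈ (box R)⁴} (∏ⱼ |ρ δᵈ f(δuⱼ)|) |U₄^R(u)| ≤ M_f⁴ A (∫ ω(χ)² d(law_R))²`
for `f` bounded by `M_f` and vanishing outside `[-r_f, r_f]ᵈ`, `ρ ≥ 0`, and a plateau function
`χ ≥ 0`, `χ ≥ 1` on `[-1,1]ᵈ` (truncation to the support, `Λ_L ⊆ Λ_{1/δ} ⊆ box R`, and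
`(ρδᵈ)² ∑_{Λ_{1/δ}²} S₂^R ≤ ∫ ω(χ)²` by `S₂^R ≥ 0`). [folklore] -/
theorem eventually_smearedUrsellSum_le {g κ J δ ρ : ℝ} (hg : 0 < g) (hJ : 0 ≤ J) (hδ : 0 < δ)
    (hρ : 0 ≤ ρ) {f χ : 𝓢(EuclideanSpace ℝ (Fin d), ℝ)} {rf Mf : ℝ} (hMf0 : 0 ≤ Mf)
    (hMf : ∀ y, |f y| ≤ Mf) (hrf : ∀ y : EuclideanSpace ℝ (Fin d), f y ≠ 0 → ∀ i, |y i| ≤ rf)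
    (hχ0 : ∀ y, 0 ≤ χ y) (hχ1 : ∀ y : EuclideanSpace ℝ (Fin d), (∀ i, |y i| ≤ 1) → 1 ≤ χ y)
    {L A : ℝ} (hL : L ≤ 1 / δ) (hA : 0 ≤ A)
    (hUΛ : ∀ᶠ R : ℕ in atTop,
      ∑ u ∈ Fintype.piFinset (fun _ : Fin 4 => latticeBox d (rf / δ)),
          |connectedFour (phi4BoxMeasure d R g κ J) (fun (z : ZSite d) (φ : ZSite d → ℝ) => φ z) u| ≤
        A * (∑ x ∈ latticeBox d L, ∑ y ∈ latticeBox d L, phi4TwoPointBox d R g κ J x y) ^ 2) :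
    ∀ᶠ R : ℕ in atTop,
      (∑ u ∈ Fintype.piFinset (fun _ : Fin 4 => box d R),
          (∏ j, |ρ * δ ^ d * f (δ • siteToE (u j))|) *
            |connectedFour (phi4BoxMeasure d R g κ J)
              (fun (z : ZSite d) (φ : ZSite d → ℝ) => φ z) u|) ≤
        Mf ^ 4 * A * (∫ ω, (ω χ) ^ 2 ∂(latticeFieldLaw (phi4BoxMeasure d R g κ J) (box d R) δ ρ)) ^ 2 := by
  classical
  filter_upwards [hUΛ, eventually_ge_atTop ⌈1 / δ⌉₊] with R hUR hR
  set c : ℝ := ρ * δ ^ d with hc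
  have hc0 : 0 ≤ c := mul_nonneg hρ (pow_nonneg hδ.le _)
  set S : ZSite d → ZSite d → ℝ := phi4TwoPointBox d R g κ J with hSdef
  have hS0 : ∀ x y, 0 ≤ S x y := fun x y => phi4TwoPointIn_nonneg d (box d R) hg κ hJ x y
  set U : (Fin 4 → ZSite d) → ℝ := fun u =>
    connectedFour (phi4BoxMeasure d R g κ J) (fun (z : ZSite d) (φ : ZSite d → ℝ) => φ z) u with hUdef
  have hRδ : 1 / δ ≤ (R : ℝ) := (Nat.le_ceil _).trans (by exact_mod_cast hR)
  have hsub : latticeBox d (1 / δ) ⊆ box d R := latticeBox_subset_box d hRδ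
  -- Step 1: truncation to the support of `f`
  have h1 : ∑ u ∈ Fintype.piFinset (fun _ : Fin 4 => box d R),
      (∏ j, |c * f (δ • siteToE (u j))|) * |U u| ≤
      (|c| * Mf) ^ 4 * ∑ u ∈ Fintype.piFinset (fun _ : Fin 4 => latticeBox d (rf / δ)), |U u| :=
    sum_prod_abs_mul_abs_le_of_support (box d R) (latticeBox d (rf / δ))
      (w := fun x => c * f (δ • siteToE x)) (mul_nonneg (abs_nonneg c) hMf0)
      (fun x => by rw [abs_mul]; exact mul_le_mul_of_nonneg_left (hMf _) (abs_nonneg c))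
      (fun x hx => by
        have hfx : f (δ • siteToE x) = 0 := by
          by_contra hne
          exact hx (mem_latticeBox_of_apply_ne_zero d hδ hrf hne)
        simp only [hfx, mul_zero]) U
  -- Step 2: the hypothesis and `Λ_L ⊆ Λ_{1/δ}`
  have hSumL0 : 0 ≤ ∑ x ∈ latticeBox d L, ∑ y ∈ latticeBox d L, S x y :=
    Finset.sum_nonneg fun x _ => Finset.sum_nonneg fun y _ => hS0 x y
  have hSumMono : ∑ x ∈ latticeBox d L, ∑ y ∈ latticeBox d L, S x y ≤
      ∑ x ∈ latticeBox d (1 / δ), ∑ y ∈ latticeBox d (1 / δ), S x y := by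
    have hLL : latticeBox d L ⊆ latticeBox d (1 / δ) := fun _ hx =>
      mem_latticeBox.2 fun i => (mem_latticeBox.1 hx i).trans hL
    calc ∑ x ∈ latticeBox d L, ∑ y ∈ latticeBox d L, S x y
        ≤ ∑ x ∈ latticeBox d L, ∑ y ∈ latticeBox d (1 / δ), S x y :=
          Finset.sum_le_sum fun x _ => Finset.sum_le_sum_of_subset_of_nonneg hLL fun y _ _ => hS0 x y
      _ ≤ ∑ x ∈ latticeBox d (1 / δ), ∑ y ∈ latticeBox d (1 / δ), S x y :=
          Finset.sum_le_sum_of_subset_of_nonneg hLL fun x _ _ =>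
            Finset.sum_nonneg fun y _ => hS0 x y
  -- Step 3: the plateau lower bound `c² ∑_{Λ_{1/δ}²} S ≤ ∫ ω(χ)²`
  have hvar : ∫ ω, (ω χ) ^ 2 ∂(latticeFieldLaw (phi4BoxMeasure d R g κ J) (box d R) δ ρ) =
      ∑ x ∈ box d R, ∑ y ∈ box d R, (c * χ (δ • siteToE x)) * (c * χ (δ • siteToE y)) * S x y :=
    integral_sq_eval_latticeFieldLaw_phi4FreeMeasure d (box d R) hg κ J δ ρ χ
  have hplat : c ^ 2 * ∑ x ∈ latticeBox d (1 / δ), ∑ y ∈ latticeBox d (1 / δ), S x y ≤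
      ∫ ω, (ω χ) ^ 2 ∂(latticeFieldLaw (phi4BoxMeasure d R g κ J) (box d R) δ ρ) := by
    rw [hvar]
    refine mul_sum_sum_le_of_plateau (latticeBox d (1 / δ)) (box d R) hsub hc0
      (fun x _ => mul_nonneg hc0 (hχ0 _)) (fun x hx => ?_) hS0
    have h1x : 1 ≤ χ (δ • siteToE x) := hχ1 _ fun i => by
      rw [PiLp.smul_apply, siteToE_apply, smul_eq_mul, abs_mul, abs_of_pos hδ]
      have := mem_latticeBox.1 hx i
      rw [le_div_iff₀ hδ] at this
      linarith
    nlinarith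
  have hplat0 : 0 ≤ c ^ 2 * ∑ x ∈ latticeBox d (1 / δ), ∑ y ∈ latticeBox d (1 / δ), S x y :=
    mul_nonneg (sq_nonneg c) (Finset.sum_nonneg fun x _ => Finset.sum_nonneg fun y _ => hS0 x y)
  -- assembling
  calc ∑ u ∈ Fintype.piFinset (fun _ : Fin 4 => box d R),
        (∏ j, |c * f (δ • siteToE (u j))|) * |U u|
      ≤ (|c| * Mf) ^ 4 * ∑ u ∈ Fintype.piFinset (fun _ : Fin 4 => latticeBox d (rf / δ)), |U u| := h1
    _ ≤ (|c| * Mf) ^ 4 * (A * (∑ x ∈ latticeBox d L, ∑ y ∈ latticeBox d L, S x y) ^ 2) :=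
        mul_le_mul_of_nonneg_left hUR (by positivity)
    _ = Mf ^ 4 * A * (c ^ 2 * ∑ x ∈ latticeBox d L, ∑ y ∈ latticeBox d L, S x y) ^ 2 := by
        rw [mul_pow, show |c| ^ 4 = (c ^ 2) ^ 2 by rw [← sq_abs c]; ring]
        ring
    _ ≤ Mf ^ 4 * A * (c ^ 2 * ∑ x ∈ latticeBox d (1 / δ), ∑ y ∈ latticeBox d (1 / δ), S x y) ^ 2 :=
        mul_le_mul_of_nonneg_left (pow_le_pow_left₀ (mul_nonneg (sq_nonneg c) hSumL0)
          (mul_le_mul_of_nonneg_left hSumMono (sq_nonneg c)) 2) (by positivity)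
    _ ≤ Mf ^ 4 * A * (∫ ω, (ω χ) ^ 2 ∂(latticeFieldLaw (phi4BoxMeasure d R g κ J) (box d R) δ ρ)) ^ 2 :=
        mul_le_mul_of_nonneg_left (pow_le_pow_left₀ hplat0 hplat 2) (by positivity)

/-- **Variance comparison at mesh `δ` from the printed two-point doubling.** If, eventually in
`R`, `∑_{x,y ∈ Λ_{r_h/δ}} S₂^R ≤ C ∑_{x,y ∈ Λ_{1/δ}} S₂^R`, then eventually
`∫ ω(h)² d(law_R) ≤ M_h² C ∫ ω(χ)² d(law_R)` for `h` bounded by `M_h` and vanishing outside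
`[-r_h, r_h]ᵈ`, `ρ ≥ 0`, and a plateau function `χ`. [folklore] -/
theorem eventually_variance_le_plateau {g κ J δ ρ : ℝ} (hg : 0 < g) (hJ : 0 ≤ J) (hδ : 0 < δ)
    (hρ : 0 ≤ ρ) {h χ : 𝓢(EuclideanSpace ℝ (Fin d), ℝ)} {rh Mh : ℝ} (hMh0 : 0 ≤ Mh)
    (hMh : ∀ y, |h y| ≤ Mh) (hrh : ∀ y : EuclideanSpace ℝ (Fin d), h y ≠ 0 → ∀ i, |y i| ≤ rh)
    (hχ0 : ∀ y, 0 ≤ χ y) (hχ1 : ∀ y : EuclideanSpace ℝ (Fin d), (∀ i, |y i| ≤ 1) → 1 ≤ χ y)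
    {C : ℝ} (hC : 0 ≤ C)
    (hSumR : ∀ᶠ R : ℕ in atTop,
      ∑ x ∈ latticeBox d (rh / δ), ∑ y ∈ latticeBox d (rh / δ), phi4TwoPointBox d R g κ J x y ≤
        C * ∑ x ∈ latticeBox d (1 / δ), ∑ y ∈ latticeBox d (1 / δ), phi4TwoPointBox d R g κ J x y) :
    ∀ᶠ R : ℕ in atTop,
      ∫ ω, (ω h) ^ 2 ∂(latticeFieldLaw (phi4BoxMeasure d R g κ J) (box d R) δ ρ) ≤
        Mh ^ 2 * C * ∫ ω, (ω χ) ^ 2 ∂(latticeFieldLaw (phi4BoxMeasure d R g κ J) (box d R) δ ρ) := by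
  classical
  filter_upwards [hSumR, eventually_ge_atTop ⌈1 / δ⌉₊] with R hSum hR
  set c : ℝ := ρ * δ ^ d with hc
  have hc0 : 0 ≤ c := mul_nonneg hρ (pow_nonneg hδ.le _)
  set S : ZSite d → ZSite d → ℝ := phi4TwoPointBox d R g κ J with hSdef
  have hS0 : ∀ x y, 0 ≤ S x y := fun x y => phi4TwoPointIn_nonneg d (box d R) hg κ hJ x y
  have hRδ : 1 / δ ≤ (R : ℝ) := (Nat.le_ceil _).trans (by exact_mod_cast hR)
  have hsub : latticeBox d (1 / δ) ⊆ box d R := latticeBox_subset_box d hRδ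
  have hvarh : ∫ ω, (ω h) ^ 2 ∂(latticeFieldLaw (phi4BoxMeasure d R g κ J) (box d R) δ ρ) =
      ∑ x ∈ box d R, ∑ y ∈ box d R, (c * h (δ • siteToE x)) * (c * h (δ • siteToE y)) * S x y :=
    integral_sq_eval_latticeFieldLaw_phi4FreeMeasure d (box d R) hg κ J δ ρ h
  have hvarχ : ∫ ω, (ω χ) ^ 2 ∂(latticeFieldLaw (phi4BoxMeasure d R g κ J) (box d R) δ ρ) =
      ∑ x ∈ box d R, ∑ y ∈ box d R, (c * χ (δ • siteToE x)) * (c * χ (δ • siteToE y)) * S x y :=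
    integral_sq_eval_latticeFieldLaw_phi4FreeMeasure d (box d R) hg κ J δ ρ χ
  -- upper bound for `h` by truncation
  have h1 : ∑ x ∈ box d R, ∑ y ∈ box d R, (c * h (δ • siteToE x)) * (c * h (δ • siteToE y)) * S x y ≤
      (|c| * Mh) ^ 2 * ∑ x ∈ latticeBox d (rh / δ), ∑ y ∈ latticeBox d (rh / δ), S x y :=
    sum_sum_mul_mul_le_of_support (box d R) (latticeBox d (rh / δ))
      (w := fun x => c * h (δ • siteToE x)) (mul_nonneg (abs_nonneg c) hMh0)
      (fun x => by rw [abs_mul]; exact mul_le_mul_of_nonneg_left (hMh _) (abs_nonneg c))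
      (fun x hx => by
        have hhx : h (δ • siteToE x) = 0 := by
          by_contra hne
          exact hx (mem_latticeBox_of_apply_ne_zero d hδ hrh hne)
        simp only [hhx, mul_zero]) hS0
  -- plateau lower bound for `χ`
  have hplat : c ^ 2 * ∑ x ∈ latticeBox d (1 / δ), ∑ y ∈ latticeBox d (1 / δ), S x y ≤
      ∑ x ∈ box d R, ∑ y ∈ box d R, (c * χ (δ • siteToE x)) * (c * χ (δ • siteToE y)) * S x y := by
    refine mul_sum_sum_le_of_plateau (latticeBox d (1 / δ)) (box d R) hsub hc0
      (fun x _ => mul_nonneg hc0 (hχ0 _)) (fun x hx => ?_) hS0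
    have h1x : 1 ≤ χ (δ • siteToE x) := hχ1 _ fun i => by
      rw [PiLp.smul_apply, siteToE_apply, smul_eq_mul, abs_mul, abs_of_pos hδ]
      have := mem_latticeBox.1 hx i
      rw [le_div_iff₀ hδ] at this
      linarith
    nlinarith
  rw [hvarh, hvarχ]
  calc ∑ x ∈ box d R, ∑ y ∈ box d R, (c * h (δ • siteToE x)) * (c * h (δ • siteToE y)) * S x y
      ≤ (|c| * Mh) ^ 2 * ∑ x ∈ latticeBox d (rh / δ), ∑ y ∈ latticeBox d (rh / δ), S x y := h1
    _ ≤ (|c| * Mh) ^ 2 * (C * ∑ x ∈ latticeBox d (1 / δ), ∑ y ∈ latticeBox d (1 / δ), S x y) :=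
        mul_le_mul_of_nonneg_left hSum (by positivity)
    _ = Mh ^ 2 * C * (c ^ 2 * ∑ x ∈ latticeBox d (1 / δ), ∑ y ∈ latticeBox d (1 / δ), S x y) := by
        rw [mul_pow, sq_abs]; ring
    _ ≤ Mh ^ 2 * C *
          ∑ x ∈ box d R, ∑ y ∈ box d R, (c * χ (δ • siteToE x)) * (c * χ (δ • siteToE y)) * S x y :=
        mul_le_mul_of_nonneg_left hplat (by positivity)

end MeshInputs

/-! ### Part G. `phi44_triviality` from the Wick sandwich, the two-point doubling and the printed `U₄` smallness -/

section Assembly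

/-- **`phi44_triviality` (constructive-qft.S24, `d = 4`) from three correlation-function inputs for
the free-boundary lattice `φ⁴₄` box states** — the top-down counterpart of Aizenman–Duminil-Copin's
deduction of Thm 1.2 from Prop. 7.2 (pp. 6, 26, 28), with the whole summation / limit layer proved:

* `hW` — the upper half of the Wick sandwich in Aizenman's form (Comm. Math. Phys. 86 (1982),
  Prop. 12.1; ADC (6.3) as corrected in the tree's `AizenmanWickBound`) for every box: for `g > 0`,
  `J ≥ 0`, `n ≥ 2` and `x ∈ (box R)^{2n}`, `|S^R_{2n}(x) - 𝒢_n[S₂^R](x)| ≤ (3/2) R^R_{2n}(x)` — for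
  Ising a theorem of the tree (`aizenman_wickDeviation_le_finite_holds`), expected for `φ⁴` through
  the Griffiths–Simon approximation (`GriffithsSimonApproximation`, `PairIsing.wickDeviation_le`);
* `hD` — a doubling bound for the smeared two-point function of the box states, uniform in
  `0 ≤ J ≤ J_c` and `L ≥ 1`: `∑_{x,y ∈ Λ_{rL}} S₂^R ≤ C(r) ∑_{x,y ∈ Λ_L} S₂^R` eventually in `R`
  (the upper half of the printed variance bounds `⟨T_{f,L}²⟩ ≤ C_f`, ADC p. 6, for indicator-like
  `f`);
* `hU` — the printed smallness of the `U₄`-sum in the scaling window (ADC Prop. 7.2 / Thm 7.1 with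
  §5, the `φ⁴` twin of `Literature.Probability.LatticeModels.aizenmanDuminilCopin_ursellFourSum_le`):
  `∑_{u ∈ Λ_{rL}⁴} |U₄^R(u)| ≤ ε(L) r^k (∑_{x,y ∈ Λ_L} S₂^R)²` eventually in `R`, for `0 ≤ J ≤ J_c` in
  the window `J = J_c ∨ (0 < J ∧ L ξ(J)⁻¹ ≤ 1)`, `L, r ≥ 1`, with `ε(L) → 0` as `L → ∞`.

Proof: for a limit law `ν_δ` of the box laws at mesh `δ` (window constant `M`, rescaled to the
printed window with `L' = 1/(max M 1 · δ)`), the scale is `s(δ) = ∫ ω(χ)² dν_δ` for a plateau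
function `χ` (so the lower variance clause of `phi44_triviality_of_mgfDeviation` is an identity); for
a compactly supported `f` with majorant `h = f₁ + f₂` (`f = f₁ - f₂`, `fᵢ ≥ 0`), `hU` and `hD` give
the two eventual inputs of `abs_mgf_sub_exp_le_of_thermodynamicLimit`
(`eventually_smearedUrsellSum_le`, `eventually_variance_le_plateau`), whence
`|∫ e^{wω(f)} dν_δ - e^{w²∫ω(f)²dν_δ/2}| ≤ K(δ) G(s(δ) w²)` with
`K(δ) = 24 M_f⁴ (r_f M')^k ε(L') → 0` and `G(u) = u² e^{C_h u/2}`; `phi44_triviality_of_mgfDeviation`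
(`ContinuumLimitsPhi4GaussianDomination`) concludes. No regularity input beyond `hD`/`hU` is used; the
dimension enters only through the fact's statement. [cite: AizenmanDuminilCopinAnnals2021, arXiv:1912.07973 Thm 1.2 (p. 4), p. 6, §6.3 (p. 26), Prop. 7.2 (p. 28)] [cite: AizenmanCMP1982, Prop. 12.1, eq. (12.3)] -/
theorem phi44_triviality_of_wickDeviation
    (hW : ∀ (g κ J : ℝ), 0 < g → 0 ≤ J → ∀ (R n : ℕ), 2 ≤ n →
      ∀ p : Fin (2 * n) → ZSite 4, (∀ i, p i ∈ box 4 R) →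
        |nPoint (phi4BoxMeasure 4 R g κ J) (fun (z : ZSite 4) (φ : ZSite 4 → ℝ) => φ z) p -
            pairingSum (phi4TwoPointBox 4 R g κ J) n p| ≤
          3 / 2 * wickRemainder (phi4TwoPointBox 4 R g κ J)
            (connectedFour (phi4BoxMeasure 4 R g κ J)
              (fun (z : ZSite 4) (φ : ZSite 4 → ℝ) => φ z)) n p)
    (hD : ∀ (g κ : ℝ), 0 < g → ∀ r : ℝ, 1 ≤ r → ∃ C : ℝ, ∀ J : ℝ, 0 ≤ J →
      J ≤ phi4CriticalJ 4 g κ → ∀ L : ℝ, 1 ≤ L → ∀ᶠ R : ℕ in atTop,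
        ∑ x ∈ latticeBox 4 (r * L), ∑ y ∈ latticeBox 4 (r * L), phi4TwoPointBox 4 R g κ J x y ≤
          C * ∑ x ∈ latticeBox 4 L, ∑ y ∈ latticeBox 4 L, phi4TwoPointBox 4 R g κ J x y)
    (hU : ∀ (g κ : ℝ), 0 < g → ∃ (k : ℕ) (ε : ℝ → ℝ), Tendsto ε atTop (𝓝 0) ∧
      ∀ J L r : ℝ, 0 ≤ J → J ≤ phi4CriticalJ 4 g κ →
        (J = phi4CriticalJ 4 g κ ∨ (0 < J ∧ L * invCorrLength (phi4TwoPoint 4 g κ J) ≤ 1)) →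
        1 ≤ L → 1 ≤ r → ∀ᶠ R : ℕ in atTop,
          ∑ u ∈ Fintype.piFinset (fun _ : Fin 4 => latticeBox 4 (r * L)),
              |connectedFour (phi4BoxMeasure 4 R g κ J)
                (fun (z : ZSite 4) (φ : ZSite 4 → ℝ) => φ z) u| ≤
            ε L * r ^ k *
              (∑ x ∈ latticeBox 4 L, ∑ y ∈ latticeBox 4 L, phi4TwoPointBox 4 R g κ J x y) ^ 2) :
    phi44_triviality := by
  refine phi44_triviality_of_mgfDeviation fun g κ hg J ρ ν hJ hwin hν => ?_
  obtain ⟨M, hM⟩ := hwin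
  obtain ⟨k, ε, hε, HU⟩ := hU g κ hg
  obtain ⟨χ, hχc, hχ0, hχ1⟩ := exists_schwartz_plateau 4
  set M' : ℝ := max M 1 with hM'
  have hM'1 : 1 ≤ M' := le_max_right _ _
  have hM'0 : 0 < M' := one_pos.trans_le hM'1
  have hMM' : M ≤ M' := le_max_left _ _
  set ε' : ℝ → ℝ := fun L => max (ε L) 0 with hε'
  have hε'0 : ∀ L, 0 ≤ ε' L := fun L => le_max_right _ _
  have hεε' : ∀ L, ε L ≤ ε' L := fun L => le_max_left _ _
  have hε't : Tendsto ε' atTop (𝓝 0) := by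
    have h := hε.max (tendsto_const_nhds (x := (0 : ℝ)))
    rwa [max_self] at h
  set s : ℝ → ℝ := fun δ => ∫ ω, (ω χ) ^ 2 ∂(ν δ) with hs
  refine ⟨s, Eventually.of_forall fun δ => integral_nonneg fun _ => sq_nonneg _,
    ⟨χ, 1, hχc, one_pos, Eventually.of_forall fun δ => (one_mul _).le⟩, fun f hf => ?_⟩
  -- data attached to `f`: majorant, support cube, bounds, constants
  obtain ⟨f₁, f₂, hf₁c, hf₂c, hf₁0, hf₂0, hf12⟩ := exists_nonneg_sub_of_hasCompactSupport f hf
  set h : 𝓢(EuclideanSpace ℝ (Fin 4), ℝ) := f₁ + f₂ with hhdef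
  have hhc : HasCompactSupport h := hf₁c.add hf₂c
  have hh0 : ∀ y, 0 ≤ h y := fun y => by
    simp only [hhdef, add_apply]
    linarith [hf₁0 y, hf₂0 y]
  have hfh : ∀ y, |f y| ≤ h y := fun y => by
    rw [hf12 y]
    simp only [hhdef, add_apply]
    rw [abs_le]
    constructor <;> linarith [hf₁0 y, hf₂0 y]
  obtain ⟨rf, hrf1, hrf⟩ := exists_cube_of_hasCompactSupport 4 f hf
  obtain ⟨rh, hrh1, hrh⟩ := exists_cube_of_hasCompactSupport 4 h hhc
  obtain ⟨Mf, hMf0, hMf⟩ := exists_abs_le_of_hasCompactSupport 4 f hf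
  obtain ⟨Mh, hMh0, hMh⟩ := exists_abs_le_of_hasCompactSupport 4 h hhc
  obtain ⟨CD, hCD⟩ := hD g κ hg rh hrh1
  set C' : ℝ := max CD 0 with hC'
  have hC'0 : 0 ≤ C' := le_max_right _ _
  have hCDC' : CD ≤ C' := le_max_left _ _
  set Ch : ℝ := Mh ^ 2 * C' with hCh
  have hCh0 : 0 ≤ Ch := by positivity
  -- the rate `K` and the shape `G`
  set K : ℝ → ℝ := fun δ => 24 * Mf ^ 4 * (rf * M') ^ k * ε' (1 / (M' * δ)) with hK
  set G : ℝ → ℝ := fun u => u ^ 2 * Real.exp (Ch * u / 2) with hG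
  refine ⟨K, G, ?_, ?_, ?_⟩
  · -- `K(δ) → 0` as `δ → 0⁺`
    have h1 : Tendsto (fun δ : ℝ => 1 / (M' * δ)) (𝓝[>] 0) atTop := by
      have h0 : Tendsto (fun δ : ℝ => M'⁻¹ * δ⁻¹) (𝓝[>] 0) atTop :=
        Tendsto.const_mul_atTop (inv_pos.2 hM'0) tendsto_inv_nhdsGT_zero
      refine h0.congr fun δ => ?_
      rw [one_div, mul_inv]
    have h2 : Tendsto (fun δ => ε' (1 / (M' * δ))) (𝓝[>] 0) (𝓝 0) := hε't.comp h1
    have h3 := h2.const_mul (24 * Mf ^ 4 * (rf * M') ^ k)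
    rw [mul_zero] at h3
    exact h3
  · -- `G` is monotone on `[0, ∞)`
    intro a ha b hb hab
    have ha0 : 0 ≤ a := ha
    simp only [hG]
    exact mul_le_mul (pow_le_pow_left₀ ha0 hab 2) (Real.exp_le_exp.2 (by nlinarith))
      (Real.exp_pos _).le (sq_nonneg _)
  · -- the bound, for all small `δ` in the window
    have hδM : ∀ᶠ δ in 𝓝[>] (0 : ℝ), δ ≤ 1 / M' :=
      (eventually_le_nhds (by positivity : (0 : ℝ) < 1 / M')).filter_mono nhdsWithin_le_nhds
    have hδ0 : ∀ᶠ δ in 𝓝[>] (0 : ℝ), 0 < δ := eventually_mem_nhdsWithin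
    filter_upwards [hM, hδM, hδ0] with δ hwinδ hδM' hδ w
    -- the printed scale `L' = 1/(M' δ) ≥ 1` and radius `r' = r_f M' ≥ 1`
    set L' : ℝ := 1 / (M' * δ) with hL'
    have hMδ : M' * δ ≤ 1 := by rwa [le_div_iff₀ hM'0, mul_comm] at hδM'
    have hMδ0 : 0 < M' * δ := mul_pos hM'0 hδ
    have hL'1 : 1 ≤ L' := by rw [hL', le_div_iff₀ hMδ0, one_mul]; exact hMδ
    have hL'δ : L' ≤ 1 / δ := by
      rw [hL']
      exact one_div_le_one_div_of_le hδ (le_mul_of_one_le_left hδ.le hM'1)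
    have hδ1 : 1 ≤ 1 / δ := hL'1.trans hL'δ
    have hr'1 : 1 ≤ rf * M' := one_le_mul_of_one_le_of_one_le hrf1 hM'1
    have hrL : rf * M' * L' = rf / δ := by
      rw [hL']
      field_simp
    have hJ0 : 0 ≤ J δ := (hJ δ hδ).1
    have hJc : J δ ≤ phi4CriticalJ 4 g κ := (hJ δ hδ).2
    -- the window at scale `L'`
    have hwin' : J δ = phi4CriticalJ 4 g κ ∨
        (0 < J δ ∧ L' * invCorrLength (phi4TwoPoint 4 g κ (J δ)) ≤ 1) := by
      rcases hwinδ with h | ⟨hJpos, hξ⟩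
      · exact Or.inl h
      · refine Or.inr ⟨hJpos, ?_⟩
        have hL'0 : 0 ≤ L' := zero_le_one.trans hL'1
        calc L' * invCorrLength (phi4TwoPoint 4 g κ (J δ)) ≤ L' * (M * δ) :=
              mul_le_mul_of_nonneg_left hξ hL'0
          _ ≤ L' * (M' * δ) := mul_le_mul_of_nonneg_left
              (mul_le_mul_of_nonneg_right hMM' hδ.le) hL'0
          _ = 1 := by rw [hL']; field_simp
    -- reduce to `ρ ≥ 0`
    set ρ' : ℝ := |ρ δ| with hρ'
    have hρ'0 : 0 ≤ ρ' := abs_nonneg _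
    have hν' : TendstoInLaw (fun R : ℕ =>
        latticeFieldLaw (phi4BoxMeasure 4 R g κ (J δ)) (box 4 R) δ ρ') atTop (ν δ) := by
      simpa only [hρ', latticeFieldLaw_phi4BoxMeasure_abs_rho] using hν δ hδ
    -- the `U₄` input at mesh `δ`
    have hUΛ : ∀ᶠ R : ℕ in atTop,
        ∑ u ∈ Fintype.piFinset (fun _ : Fin 4 => latticeBox 4 (rf / δ)),
            |connectedFour (phi4BoxMeasure 4 R g κ (J δ))
              (fun (z : ZSite 4) (φ : ZSite 4 → ℝ) => φ z) u| ≤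
          (ε' L' * (rf * M') ^ k) *
            (∑ x ∈ latticeBox 4 L', ∑ y ∈ latticeBox 4 L',
              phi4TwoPointBox 4 R g κ (J δ) x y) ^ 2 := by
      have key := HU (J δ) L' (rf * M') hJ0 hJc hwin' hL'1 hr'1
      rw [hrL] at key
      filter_upwards [key] with R hR
      refine hR.trans ?_
      rw [mul_assoc, mul_assoc]
      exact mul_le_mul_of_nonneg_right (hεε' L') (mul_nonneg (pow_nonneg (zero_le_one.trans hr'1) k)
        (sq_nonneg _))
    have hA0 : 0 ≤ ε' L' * (rf * M') ^ k := mul_nonneg (hε'0 L') (pow_nonneg (zero_le_one.trans hr'1) k)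
    have hUev := eventually_smearedUrsellSum_le 4 hg hJ0 hδ hρ'0 (f := f) (χ := χ) hMf0 hMf hrf hχ0
      hχ1 hL'δ hA0 hUΛ
    -- the doubling input at mesh `δ`
    have hSumR : ∀ᶠ R : ℕ in atTop,
        ∑ x ∈ latticeBox 4 (rh / δ), ∑ y ∈ latticeBox 4 (rh / δ), phi4TwoPointBox 4 R g κ (J δ) x y ≤
          C' * ∑ x ∈ latticeBox 4 (1 / δ), ∑ y ∈ latticeBox 4 (1 / δ),
            phi4TwoPointBox 4 R g κ (J δ) x y := by
      have key := hCD (J δ) hJ0 hJc (1 / δ) hδ1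
      rw [mul_one_div] at key
      filter_upwards [key] with R hR
      refine hR.trans (mul_le_mul_of_nonneg_right hCDC' ?_)
      exact Finset.sum_nonneg fun x _ => Finset.sum_nonneg fun y _ =>
        phi4TwoPointIn_nonneg 4 (box 4 R) hg κ hJ0 x y
    have hBev := eventually_variance_le_plateau 4 hg hJ0 hδ hρ'0 (h := h) (χ := χ) hMh0 hMh hrh hχ0
      hχ1 hC'0 hSumR
    -- one mesh
    have key := abs_mgf_sub_exp_le_of_thermodynamicLimit 4 hg hJ0 hδ.le hρ'0 hν'
      (hW g κ (J δ) hg hJ0) hf (fun x => hh0 _) (fun x => hχ0 _) (fun x => hfh _)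
      (by positivity : 0 ≤ Mf ^ 4 * (ε' L' * (rf * M') ^ k)) hCh0 hUev hBev w
    rw [show w ^ 2 / 2 * ∫ ω, (ω f) ^ 2 ∂ν δ = w ^ 2 * (∫ ω, (ω f) ^ 2 ∂ν δ) / 2 by ring] at key
    refine key.trans (le_of_eq ?_)
    simp only [hK, hG, hs, hL', hCh]
    rw [show Mh ^ 2 * C' * ((∫ ω, (ω χ) ^ 2 ∂ν δ) * w ^ 2) / 2 =
      w ^ 2 / 2 * (Mh ^ 2 * C' * ∫ ω, (ω χ) ^ 2 ∂ν δ) by ring]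
    ring

/-- **`phi44_triviality` from the two-point doubling and the printed `U₄` smallness alone**: the
Wick-sandwich hypothesis `hW` of `phi44_triviality_of_wickDeviation` is the theorem
`phi4Box_wickDeviation_le` (`QuantumLattice/Phi4WickDeviation.lean`: Aizenman 1982, Prop. 12.1 for
the lattice `φ⁴` box states through the block Ising approximation). What remains assumed is `hD` (the
indicator case of the printed variance bound, ADC p. 6) and `hU` (ADC Prop. 7.2 via Thm 7.1 and §5 —
the substance of the Annals paper). [cite: AizenmanDuminilCopinAnnals2021, arXiv:1912.07973 Thm 1.2 (p. 4), p. 6, §6.3 (p. 26), Thm 7.1 / Prop. 7.2 (p. 28)] [cite: AizenmanCMP1982, Prop. 12.1, eq. (12.3)] -/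
theorem phi44_triviality_of_doubling_of_ursellFourSum
    (hD : ∀ (g κ : ℝ), 0 < g → ∀ r : ℝ, 1 ≤ r → ∃ C : ℝ, ∀ J : ℝ, 0 ≤ J →
      J ≤ phi4CriticalJ 4 g κ → ∀ L : ℝ, 1 ≤ L → ∀ᶠ R : ℕ in atTop,
        ∑ x ∈ latticeBox 4 (r * L), ∑ y ∈ latticeBox 4 (r * L), phi4TwoPointBox 4 R g κ J x y ≤
          C * ∑ x ∈ latticeBox 4 L, ∑ y ∈ latticeBox 4 L, phi4TwoPointBox 4 R g κ J x y)
    (hU : ∀ (g κ : ℝ), 0 < g → ∃ (k : ℕ) (ε : ℝ → ℝ), Tendsto ε atTop (𝓝 0) ∧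
      ∀ J L r : ℝ, 0 ≤ J → J ≤ phi4CriticalJ 4 g κ →
        (J = phi4CriticalJ 4 g κ ∨ (0 < J ∧ L * invCorrLength (phi4TwoPoint 4 g κ J) ≤ 1)) →
        1 ≤ L → 1 ≤ r → ∀ᶠ R : ℕ in atTop,
          ∑ u ∈ Fintype.piFinset (fun _ : Fin 4 => latticeBox 4 (r * L)),
              |connectedFour (phi4BoxMeasure 4 R g κ J)
                (fun (z : ZSite 4) (φ : ZSite 4 → ℝ) => φ z) u| ≤
            ε L * r ^ k *
              (∑ x ∈ latticeBox 4 L, ∑ y ∈ latticeBox 4 L, phi4TwoPointBox 4 R g κ J x y) ^ 2) :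
    phi44_triviality :=
  phi44_triviality_of_wickDeviation
    (fun _ κ _ hg hJ R _ hn p hp => phi4Box_wickDeviation_le 4 hg κ hJ R hn p hp) hD hU

/-- **`phi44_triviality` from the printed `U₄` smallness alone** (Aizenman–Duminil-Copin 2021, Thm 1.2
for lattice `φ⁴₄`, reduced to its core estimate): the Wick sandwich `hW` (Aizenman 1982, Prop. 12.1, for
the lattice `φ⁴` box states: `phi4Box_wickDeviation_le`) and the two-point doubling `hD`
(`phi4TwoPointBox_doubling`) are theorems of the tree, so `phi44_triviality` follows from the single
hypothesis `hU` — the printed smallness of `∑_{Λ_{rL}⁴} |U₄|` relative to `(∑_{Λ_L²} S₂)²` in the scaling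
window `L ξ(J)⁻¹ ≤ 1` (or `J = J_c`), uniformly in `0 ≤ J ≤ J_c`, for the free-boundary box states
eventually in the volume: ADC Prop. 7.2 via Thm 7.1 (the tree diagram bound improved by `B_L^{-c}`,
random currents for the Griffiths–Simon class) and the regularity estimates of §5. This is the `φ⁴`
twin of the tree's reduction of the Ising clause to `aizenmanDuminilCopin_ursellFourSum_le`
(`ising4_triviality_of_adcUrsellFourSum`, `ContinuumLimitsTrivialityReductionsProofs`).
[cite: AizenmanDuminilCopinAnnals2021, arXiv:1912.07973 Thm 1.2 (p. 4), p. 6, §6.3 (p. 26), Thm 7.1 / Prop. 7.2 (p. 28), §5 (pp. 16–20)] [cite: AizenmanCMP1982, Prop. 12.1, eq. (12.3)] -/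
theorem phi44_triviality_of_ursellFourSum
    (hU : ∀ (g κ : ℝ), 0 < g → ∃ (k : ℕ) (ε : ℝ → ℝ), Tendsto ε atTop (𝓝 0) ∧
      ∀ J L r : ℝ, 0 ≤ J → J ≤ phi4CriticalJ 4 g κ →
        (J = phi4CriticalJ 4 g κ ∨ (0 < J ∧ L * invCorrLength (phi4TwoPoint 4 g κ J) ≤ 1)) →
        1 ≤ L → 1 ≤ r → ∀ᶠ R : ℕ in atTop,
          ∑ u ∈ Fintype.piFinset (fun _ : Fin 4 => latticeBox 4 (r * L)),
              |connectedFour (phi4BoxMeasure 4 R g κ J)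
                (fun (z : ZSite 4) (φ : ZSite 4 → ℝ) => φ z) u| ≤
            ε L * r ^ k *
              (∑ x ∈ latticeBox 4 L, ∑ y ∈ latticeBox 4 L, phi4TwoPointBox 4 R g κ J x y) ^ 2) :
    phi44_triviality :=
  phi44_triviality_of_doubling_of_ursellFourSum
    (fun g κ hg r hr => by
      obtain ⟨C, -, hC⟩ := phi4TwoPointBox_doubling 4 hg κ (r := r) (by linarith)
      exact ⟨C, fun J hJ _ L hL => hC J hJ L hL⟩)
    hU

/-! ### Part H. `d ≥ 5`: `phi4_highDim_triviality` from the `U₄` smallness of Panis's form -/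

/-- **`phi4_highDim_triviality` (constructive-qft.S24, `d ≥ 5`; Aizenman 1982 / Fröhlich 1982) from the
printed `U₄` smallness alone.** The same summation layer in general dimension — Aizenman's Prop. 12.1
(`phi4Box_wickDeviation_le`), the two-point doubling (`phi4TwoPointBox_doubling`), the one-mesh
passage to the thermodynamic limit (`abs_mgf_sub_exp_le_of_thermodynamicLimit`) and the law-level
assembly `phi4_highDim_triviality_of_scaleBound` (with its exponential-integrability clause discharged
by `phi4_thermodynamicLimit_integrable_exp`) — reduce the `d ≥ 5` fact to the single hypothesis `hU`:
for `d ≥ 5`, `g > 0`, `κ` and every `J₀ > 0` there are `k` and `ε(L) → 0` with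
`∑_{u ∈ Λ_{rL}⁴} |U₄^R(u)| ≤ ε(L) r^k (∑_{Λ_L²} S₂^R)²` eventually in `R`, for all `J₀ ≤ J ≤ J_c`,
`L, r ≥ 1` — the `φ⁴` twin of Panis 2023, Thm 5.5 / the tree's `panis_ursellFourSum_le` (there
`ε(L) = C (J₀⁻⁴ ∨ J₀⁻²) L^{-(d-4)}`: the unimproved tree diagram bound with the infrared bound, Aizenman
1982 §13 / ADC §6.3 "bounds on (1)–(4) without the `d = 4` improvement"). No scaling window is needed
(`phi4_highDim_triviality` asks `J(δ) ≥ J₀ > 0` eventually). [cite: AizenmanDuminilCopinAnnals2021, arXiv:1912.07973 §1.3 (p. 5), §6.3 (p. 26)] [cite: AizenmanCMP1982, Prop. 12.1 and §13, (13.1)] [cite: Panis2023Triviality, Thm 5.5] -/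
theorem phi4_highDim_triviality_of_ursellFourSum
    (hU : ∀ (d : ℕ), 5 ≤ d → ∀ (g κ : ℝ), 0 < g → ∀ J₀ : ℝ, 0 < J₀ →
      ∃ (k : ℕ) (ε : ℝ → ℝ), Tendsto ε atTop (𝓝 0) ∧
        ∀ J L r : ℝ, J₀ ≤ J → J ≤ phi4CriticalJ d g κ → 1 ≤ L → 1 ≤ r → ∀ᶠ R : ℕ in atTop,
          ∑ u ∈ Fintype.piFinset (fun _ : Fin 4 => latticeBox d (r * L)),
              |connectedFour (phi4BoxMeasure d R g κ J)
                (fun (z : ZSite d) (φ : ZSite d → ℝ) => φ z) u| ≤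
            ε L * r ^ k *
              (∑ x ∈ latticeBox d L, ∑ y ∈ latticeBox d L, phi4TwoPointBox d R g κ J x y) ^ 2) :
    phi4_highDim_triviality := by
  refine phi4_highDim_triviality_of_scaleBound fun d hd g κ hg J ρ ν hJ hJ0 hν => ?_
  obtain ⟨J₀, hJ₀, hJ₀le⟩ := hJ0
  obtain ⟨k, ε, hε, HU⟩ := hU d hd g κ hg J₀ hJ₀
  obtain ⟨χ, hχc, hχ0, hχ1⟩ := exists_schwartz_plateau d
  set ε' : ℝ → ℝ := fun L => max (ε L) 0 with hε'
  have hε'0 : ∀ L, 0 ≤ ε' L := fun L => le_max_right _ _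
  have hεε' : ∀ L, ε L ≤ ε' L := fun L => le_max_left _ _
  have hε't : Tendsto ε' atTop (𝓝 0) := by
    have h := hε.max (tendsto_const_nhds (x := (0 : ℝ)))
    rwa [max_self] at h
  set s : ℝ → ℝ := fun δ => ∫ ω, (ω χ) ^ 2 ∂(ν δ) with hs
  refine ⟨s, Eventually.of_forall fun δ => integral_nonneg fun _ => sq_nonneg _,
    ⟨χ, 1, hχc, one_pos, Eventually.of_forall fun δ => (one_mul _).le⟩, fun f hf => ?_⟩
  -- data attached to `f`
  obtain ⟨f₁, f₂, hf₁c, hf₂c, hf₁0, hf₂0, hf12⟩ := exists_nonneg_sub_of_hasCompactSupport f hf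
  set h : 𝓢(EuclideanSpace ℝ (Fin d), ℝ) := f₁ + f₂ with hhdef
  have hhc : HasCompactSupport h := hf₁c.add hf₂c
  have hh0 : ∀ y, 0 ≤ h y := fun y => by
    simp only [hhdef, add_apply]
    linarith [hf₁0 y, hf₂0 y]
  have hfh : ∀ y, |f y| ≤ h y := fun y => by
    rw [hf12 y]
    simp only [hhdef, add_apply]
    rw [abs_le]
    constructor <;> linarith [hf₁0 y, hf₂0 y]
  obtain ⟨rf, hrf1, hrf⟩ := exists_cube_of_hasCompactSupport d f hf
  obtain ⟨rh, hrh1, hrh⟩ := exists_cube_of_hasCompactSupport d h hhc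
  obtain ⟨Mf, hMf0, hMf⟩ := exists_abs_le_of_hasCompactSupport d f hf
  obtain ⟨Mh, hMh0, hMh⟩ := exists_abs_le_of_hasCompactSupport d h hhc
  obtain ⟨CD, hCD0, hCD⟩ := phi4TwoPointBox_doubling d hg κ (r := rh) (by linarith)
  set Ch : ℝ := Mh ^ 2 * CD with hCh
  have hCh0 : 0 ≤ Ch := by positivity
  set K : ℝ → ℝ := fun δ => 24 * Mf ^ 4 * rf ^ k * ε' (1 / δ) with hK
  set G : ℝ → ℝ := fun u => u ^ 2 * Real.exp (Ch * u / 2) with hG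
  have hδ0 : ∀ᶠ δ in 𝓝[>] (0 : ℝ), 0 < δ := eventually_mem_nhdsWithin
  refine ⟨K, G, ?_, ?_, ?_, ?_⟩
  · -- `K(δ) → 0`
    have h2 : Tendsto (fun δ : ℝ => ε' (1 / δ)) (𝓝[>] 0) (𝓝 0) := by
      refine hε't.comp ?_
      have h1 : Tendsto (fun δ : ℝ => δ⁻¹) (𝓝[>] (0 : ℝ)) atTop := tendsto_inv_nhdsGT_zero
      exact h1.congr fun δ => (one_div δ).symm
    have h3 := h2.const_mul (24 * Mf ^ 4 * rf ^ k)
    rw [mul_zero] at h3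
    exact h3
  · -- `G` monotone on `[0, ∞)`
    intro a ha b hb hab
    have ha0 : 0 ≤ a := ha
    simp only [hG]
    exact mul_le_mul (pow_le_pow_left₀ ha0 hab 2) (Real.exp_le_exp.2 (by nlinarith))
      (Real.exp_pos _).le (sq_nonneg _)
  · -- exponential integrability under `ν δ`
    filter_upwards [hδ0] with δ hδ w
    exact phi4_thermodynamicLimit_integrable_exp hg (hJ δ hδ).1 hδ.le (hν δ hδ) f hf w
  · -- the bound, for all small `δ` with `J δ ≥ J₀`
    have hδ1 : ∀ᶠ δ in 𝓝[>] (0 : ℝ), δ ≤ 1 :=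
      (eventually_le_nhds one_pos).filter_mono nhdsWithin_le_nhds
    filter_upwards [hJ₀le, hδ1, hδ0] with δ hJ₀δ hδ1' hδ w
    set L : ℝ := 1 / δ with hL
    have hL1 : 1 ≤ L := by rw [hL, le_div_iff₀ hδ, one_mul]; exact hδ1'
    have hJ0' : 0 ≤ J δ := (hJ δ hδ).1
    have hJc : J δ ≤ phi4CriticalJ d g κ := (hJ δ hδ).2
    have hrL : rf * L = rf / δ := by rw [hL, mul_one_div]
    -- reduce to `ρ ≥ 0`
    set ρ' : ℝ := |ρ δ| with hρ'
    have hρ'0 : 0 ≤ ρ' := abs_nonneg _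
    have hν' : TendstoInLaw (fun R : ℕ =>
        latticeFieldLaw (phi4BoxMeasure d R g κ (J δ)) (box d R) δ ρ') atTop (ν δ) := by
      simpa only [hρ', latticeFieldLaw_phi4BoxMeasure_abs_rho] using hν δ hδ
    -- the `U₄` input at mesh `δ`
    have hUΛ : ∀ᶠ R : ℕ in atTop,
        ∑ u ∈ Fintype.piFinset (fun _ : Fin 4 => latticeBox d (rf / δ)),
            |connectedFour (phi4BoxMeasure d R g κ (J δ))
              (fun (z : ZSite d) (φ : ZSite d → ℝ) => φ z) u| ≤
          (ε' L * rf ^ k) *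
            (∑ x ∈ latticeBox d L, ∑ y ∈ latticeBox d L, phi4TwoPointBox d R g κ (J δ) x y) ^ 2 := by
      have key := HU (J δ) L rf hJ₀δ hJc hL1 hrf1
      rw [hrL] at key
      filter_upwards [key] with R hR
      refine hR.trans ?_
      rw [mul_assoc, mul_assoc]
      exact mul_le_mul_of_nonneg_right (hεε' L)
        (mul_nonneg (pow_nonneg (zero_le_one.trans hrf1) k) (sq_nonneg _))
    have hA0 : 0 ≤ ε' L * rf ^ k := mul_nonneg (hε'0 L) (pow_nonneg (zero_le_one.trans hrf1) k)
    have hUev := eventually_smearedUrsellSum_le d hg hJ0' hδ hρ'0 (f := f) (χ := χ) hMf0 hMf hrf hχ0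
      hχ1 (le_of_eq hL.symm) hA0 hUΛ
    -- the doubling input at mesh `δ`
    have hSumR : ∀ᶠ R : ℕ in atTop,
        ∑ x ∈ latticeBox d (rh / δ), ∑ y ∈ latticeBox d (rh / δ), phi4TwoPointBox d R g κ (J δ) x y ≤
          CD * ∑ x ∈ latticeBox d (1 / δ), ∑ y ∈ latticeBox d (1 / δ),
            phi4TwoPointBox d R g κ (J δ) x y := by
      have key := hCD (J δ) hJ0' L hL1
      rwa [hL, mul_one_div] at key
    have hBev := eventually_variance_le_plateau d hg hJ0' hδ hρ'0 (h := h) (χ := χ) hMh0 hMh hrh hχ0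
      hχ1 hCD0 hSumR
    -- one mesh
    have key := abs_mgf_sub_exp_le_of_thermodynamicLimit d hg hJ0' hδ.le hρ'0 hν'
      (fun R n hn p hp => phi4Box_wickDeviation_le d hg κ hJ0' R hn p hp) hf (fun x => hh0 _)
      (fun x => hχ0 _) (fun x => hfh _)
      (by positivity : 0 ≤ Mf ^ 4 * (ε' L * rf ^ k)) hCh0 hUev hBev w
    rw [show w ^ 2 / 2 * ∫ ω, (ω f) ^ 2 ∂ν δ = w ^ 2 * (∫ ω, (ω f) ^ 2 ∂ν δ) / 2 by ring] at key
    refine key.trans (le_of_eq ?_)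
    simp only [hK, hG, hs, hL, hCh]
    rw [show Mh ^ 2 * CD * ((∫ ω, (ω χ) ^ 2 ∂ν δ) * w ^ 2) / 2 =
      w ^ 2 / 2 * (Mh ^ 2 * CD * ∫ ω, (ω χ) ^ 2 ∂ν δ) by ring]
    ring

end Assembly

end Literature.MathematicalPhysics.QuantumFieldTheory

end
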